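import Literature.Analysis.FluidPDE.ElgindiEllipticAssembly
import Literature.Analysis.FluidPDE.ElgindiEllipticHkTools

import HarnessLib

/-!
# The `𝓗⁴` elliptic a-priori estimate in the tree's norm — part B: `αD_RΨ`
([ElgindiGhoulMasmoudi2021] §6 Theorem 3 for `k = 4`; [Elgindi2021] §7.3–7.4)

Topic `Literature/Analysis/FluidPDE`. Proof file (everything proved, no definitions, no named
facts) on the proof path of the named fact
`Literature.Analysis.FluidPDE.Elgindi.ElgindiGhoulMasmoudi2021_stabilityCore`
(`ElgindiStabilityDecomposition.lean`). T. M. Elgindi, T.-E. Ghoul, N. Masmoudi, Camb. J. Math. 9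
(2021) = arXiv:1910.14071, §6 (p. 15 of the held text):

> "**Theorem 3.** Let `k ≥ 2`, `0 < α` sufficiently small and assume `F ∈ 𝓗ᵏ` satisfies the above
> orthogonality condition. Then the unique solution to (6.1) satisfies
> `α²|D_R²Ψ|_{𝓗ᵏ} + α|D_RΨ|_{𝓗ᵏ} + |∂_θθΨ|_{𝓗ᵏ} ≤ C_k|F|_{𝓗ᵏ}` for some `C_k > 0` depending on `k`
> but independent of `α`."

This part bounds every term of `|αD_RΨ|²_{𝓗⁴}` by `3·10²³·D`, `D` the datum of
`elliptic_apriori_levels` (`ElgindiEllipticAssembly.lean`), hence the functional by `30·ofReal(3·10²³·D)`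
(theorem `eHkNormSq_Dz_le`).
-/

noncomputable section

open MeasureTheory Set Real Filter Function Finset
open _root_.Topology
open scoped ENNReal

namespace Literature.Analysis.FluidPDE

namespace Elgindi

set_option linter.unusedSimpArgs false in
set_option linter.unusedTactic false in
set_option linter.unreachableTactic false in
set_option maxRecDepth 4000 in
set_option maxHeartbeats 8000000 in
/-- **part B: `αD_RΨ`**: `eHkNormSq α 4 (α • Dz Ψ) ≤ 30·ofReal (3·10²³·D)` in the a-priori class (see the module
docstring). [cite: ElgindiGhoulMasmoudi2021, §6 Theorem 3 (p. 15 of arXiv:1910.14071)]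
[cite: Elgindi2021, §7.3 Proposition 7.7 and §7.4 Proposition 7.9 (p. 21–23 of arXiv:1904.04795)] -/
theorem eHkNormSq_Dz_le {α : ℝ} (hα : 0 < α) (hα4 : α ≤ 1 / 4) {χ : ℝ → ℝ → ℝ}
    (hχ : ContDiff ℝ 10 (uncurry χ)) (hs : HasCompactSupport (uncurry χ)) (hpos : ∀ p ∈ tsupport (uncurry χ), 0 < p.1)
    (hχ0 : ∀ R, χ R 0 = 0) {Ψ gF : ℝ → ℝ → ℝ} (hΨ : Ψ = fun R θ => Real.cos θ * χ R θ)
    (horth : ∀ R, 0 < R → ∫ θ in Ioo 0 (π / 2), ellipticOp α Ψ R θ * kernelK θ = 0)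
    (hgF : gF = fun R θ => -α ^ 2 * R ^ 2 * dz (dz Ψ) R θ - α * (5 + α) * R * dz Ψ R θ -
      dθ (dθ Ψ) R θ + (Real.cos θ * χ R θ + Real.sin θ * dθ χ R θ) - 6 * Ψ R θ)
    {D : ℝ} (hD : D = ((∫ p in strip, radialWeight p.1 ^ 2 * ellipticOp α Ψ p.1 p.2 ^ 2 * Real.sin (2 * p.2) ^ (-eta)) + (∫ p in strip, radialWeight p.1 ^ 2 * (Dz^[1] (ellipticOp α Ψ)) p.1 p.2 ^ 2 * Real.sin (2 * p.2) ^ (-eta)) + (∫ p in strip, radialWeight p.1 ^ 2 * (Dz^[2] (ellipticOp α Ψ)) p.1 p.2 ^ 2 * Real.sin (2 * p.2) ^ (-eta)) + (∫ p in strip, radialWeight p.1 ^ 2 * (Dz^[3] (ellipticOp α Ψ)) p.1 p.2 ^ 2 * Real.sin (2 * p.2) ^ (-eta)) + (∫ p in strip, radialWeight p.1 ^ 2 * (Dz^[4] (ellipticOp α Ψ)) p.1 p.2 ^ 2 * Real.sin (2 * p.2) ^ (-eta)) +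
        (∫ p in strip, radialWeight p.1 ^ 2 * dθ gF p.1 p.2 ^ 2 * Real.sin (2 * p.2) ^ (2 - gammaExp α)) +
        (∫ p in strip, radialWeight p.1 ^ 2 * dθ (Dz^[1] gF) p.1 p.2 ^ 2 * Real.sin (2 * p.2) ^ (2 - gammaExp α)) +
        (∫ p in strip, radialWeight p.1 ^ 2 * dθ (Dz^[2] gF) p.1 p.2 ^ 2 * Real.sin (2 * p.2) ^ (2 - gammaExp α)) +
        (∫ p in strip, radialWeight p.1 ^ 2 * dθ (Dz^[3] gF) p.1 p.2 ^ 2 * Real.sin (2 * p.2) ^ (2 - gammaExp α)) +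
        (∫ p in strip, radialWeight p.1 ^ 2 * dθ (dθ gF) p.1 p.2 ^ 2 * Real.sin (2 * p.2) ^ (4 - gammaExp α)) +
        (∫ p in strip, radialWeight p.1 ^ 2 * dθ (dθ (Dz^[1] gF)) p.1 p.2 ^ 2 * Real.sin (2 * p.2) ^ (4 - gammaExp α)) +
        (∫ p in strip, radialWeight p.1 ^ 2 * dθ (dθ (Dz^[2] gF)) p.1 p.2 ^ 2 * Real.sin (2 * p.2) ^ (4 - gammaExp α)) +
        (∫ p in strip, radialWeight p.1 ^ 2 * (dθ^[3] gF) p.1 p.2 ^ 2 * Real.sin (2 * p.2) ^ (6 - gammaExp α)) +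
        (∫ p in strip, radialWeight p.1 ^ 2 * (dθ^[3] (Dz^[1] gF)) p.1 p.2 ^ 2 * Real.sin (2 * p.2) ^ (6 - gammaExp α)) +
        (∫ p in strip, radialWeight p.1 ^ 2 * (dθ^[4] gF) p.1 p.2 ^ 2 * Real.sin (2 * p.2) ^ (8 - gammaExp α)))) :
    eHkNormSq α 4 (α • Dz Ψ) ≤ 30 * ENNReal.ofReal (300000000000000000000000 * D) := by
  have hχ8 : ContDiff ℝ 8 (uncurry χ) := hχ.of_le (by norm_num)
  obtain ⟨res10, res11, res12, res13, res20, res21, res22, res30, res31, res40⟩ :=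
    elliptic_apriori_levels hα hα4 hχ8 hs hpos hχ0 hΨ horth hgF hD
  have hα1 : α ≤ 1 := by linarith
  have hα2 : α ^ 2 ≤ 1 := by nlinarith
  have hα4' : α ^ 4 ≤ 1 := by nlinarith
  have hα20 : 0 ≤ α ^ 2 := by positivity
  have hα40 : 0 ≤ α ^ 4 := by positivity
  have hγ1 : 1 < gammaExp α := one_lt_gammaExp hα
  have hγ2 : gammaExp α ≤ 41 / 40 := by unfold gammaExp; linarith
  have hWc : ContinuousOn (fun R => radialWeight R ^ 2) (Ioi 0) := (contDiffOn_radialWeight_sq (n := 0)).continuousOn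
  have hW0 : ∀ R, 0 < R → 0 ≤ (fun R => radialWeight R ^ 2) R := fun R _ => sq_nonneg _
  have hsin : ∀ p ∈ strip, 0 < Real.sin (2 * p.2) := fun p hp => Real.sin_pos_of_pos_of_lt_pi (by linarith [hp.2.1]) (by linarith [hp.2.2])
  -- regularity bookkeeping
  have hΨc : ContDiff ℝ 10 (uncurry Ψ) := by rw [hΨ]; exact contDiff_cosProfile hχ
  have hΨs : HasCompactSupport (uncurry Ψ) := by rw [hΨ]; exact hasCompactSupport_cosProfile hs
  have hΨsub : tsupport (uncurry Ψ) ⊆ tsupport (uncurry χ) := by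
    refine tsupport_subset_of_eq_zero (X := uncurry χ) (g := uncurry Ψ) fun p hp => ?_
    show Ψ p.1 p.2 = 0
    rw [hΨ]; simp [show χ p.1 p.2 = 0 from hp]
  have regχ3 : ∀ m, m ≤ 4 → ContDiff ℝ ((3 + m : ℕ) : WithTop ℕ∞) (uncurry χ) := fun m hm =>
    hχ.of_le (by exact_mod_cast (show 3 + m ≤ 10 by omega))
  have cΨ : ∀ n m : ℕ, n + m ≤ 10 → Continuous fun p : ℝ × ℝ => (dθ^[n] (Dz^[m] Ψ)) p.1 p.2 := by
    intro n m h
    have h1 : ContDiff ℝ ((n + m : ℕ) : WithTop ℕ∞) (uncurry Ψ) := hΨc.of_le (by exact_mod_cast h)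
    have h2 : ContDiff ℝ (n : ℕ) (uncurry (Dz^[m] Ψ)) := contDiff_iterate_Dz_of_contDiff (m := m) (n := n) (by exact_mod_cast h1)
    exact (contDiff_iterate_dθ_of_contDiff (n := n) (m := 0) (by simpa using h2)).continuous
  have sΨ : ∀ n m : ℕ, HasCompactSupport fun p : ℝ × ℝ => (dθ^[n] (Dz^[m] Ψ)) p.1 p.2 := fun n m =>
    hasCompactSupport_iterate_dθ (hasCompactSupport_iterate_Dz hΨs m) n
  have pΨ : ∀ n m : ℕ, ∀ p ∈ tsupport (fun p : ℝ × ℝ => (dθ^[n] (Dz^[m] Ψ)) p.1 p.2), 0 < p.1 := fun n m p hp =>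
    hpos p (hΨsub ((tsupport_iterate_Dz_subset m) ((tsupport_iterate_dθ_subset n) hp)))
  have regΨj4 : ∀ j : ℕ, j ≤ 6 → ContDiff ℝ 4 (uncurry (Dz^[j] Ψ)) := by
    intro j hj
    have h1 : ContDiff ℝ ((4 + j : ℕ) : WithTop ℕ∞) (uncurry Ψ) := hΨc.of_le (by exact_mod_cast (show 4 + j ≤ 10 by omega))
    have := contDiff_iterate_Dz_of_contDiff (m := j) (n := 4) (by exact_mod_cast h1); exact_mod_cast this
  have regΨdd : ∀ j : ℕ, j ≤ 4 → ContDiff ℝ 4 (uncurry (Dz^[j] (dθ (dθ Ψ)))) := by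
    intro j hj
    have h1 : ContDiff ℝ ((4 + j + 1 + 1 : ℕ) : WithTop ℕ∞) (uncurry Ψ) := hΨc.of_le (by exact_mod_cast (show 4 + j + 1 + 1 ≤ 10 by omega))
    have h2 : ContDiff ℝ ((4 + j + 1 : ℕ) : WithTop ℕ∞) (uncurry (dθ Ψ)) := contDiff_dθ_of_contDiff (by exact_mod_cast h1)
    have h3 : ContDiff ℝ ((4 + j : ℕ) : WithTop ℕ∞) (uncurry (dθ (dθ Ψ))) := contDiff_dθ_of_contDiff (by exact_mod_cast h2)
    have := contDiff_iterate_Dz_of_contDiff (m := j) (n := 4) (by exact_mod_cast h3); exact_mod_cast this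
  have regΨnm : ∀ n m : ℕ, n + m + 2 ≤ 10 → ContDiff ℝ ((n + m + 2 : ℕ) : WithTop ℕ∞) (uncurry Ψ) := fun n m h =>
    hΨc.of_le (by exact_mod_cast h)
  have cZ : ∀ m : ℕ, m ≤ 5 → Continuous fun p : ℝ × ℝ => p.1 * dz (dθ (Dz^[m] Ψ)) p.1 p.2 := by
    intro m hm
    have h1 : ContDiff ℝ ((2 + m : ℕ) : WithTop ℕ∞) (uncurry Ψ) := hΨc.of_le (by exact_mod_cast (show 2 + m ≤ 10 by omega))
    have h2 : ContDiff ℝ 2 (uncurry (Dz^[m] Ψ)) := by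
      have := contDiff_iterate_Dz_of_contDiff (m := m) (n := 2) (by exact_mod_cast h1); exact_mod_cast this
    have h3 : ContDiff ℝ 1 (uncurry (dθ (Dz^[m] Ψ))) := contDiff_dθ_of_contDiff h2
    have h4 : ContDiff ℝ 0 (uncurry (dz (dθ (Dz^[m] Ψ)))) := contDiff_dz_of_contDiff h3
    exact continuous_fst.mul h4.continuous
  have sZ : ∀ m : ℕ, HasCompactSupport fun p : ℝ × ℝ => p.1 * dz (dθ (Dz^[m] Ψ)) p.1 p.2 := fun m =>
    (hasCompactSupport_dz (hasCompactSupport_dθ_of (hasCompactSupport_iterate_Dz hΨs m))).mul_left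
  have pZ : ∀ m : ℕ, ∀ p ∈ tsupport (fun p : ℝ × ℝ => p.1 * dz (dθ (Dz^[m] Ψ)) p.1 p.2), 0 < p.1 := by
    intro m p hp
    refine hpos p (hΨsub ((tsupport_iterate_Dz_subset m) ((tsupport_dθ_subset' _) (tsupport_dz_subset ?_))))
    exact (tsupport_mul_subset_right (f := fun p : ℝ × ℝ => p.1) (g := uncurry (dz (dθ (Dz^[m] Ψ))))) hp
  have cdd : ∀ m : ℕ, m ≤ 6 → Continuous fun p : ℝ × ℝ => p.1 ^ 2 * dz (dz (Dz^[m] Ψ)) p.1 p.2 := by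
    intro m hm
    have h2 : ContDiff ℝ 2 (uncurry (Dz^[m] Ψ)) := (regΨj4 m hm).of_le (by norm_num)
    have h3 : ContDiff ℝ 1 (uncurry (dz (Dz^[m] Ψ))) := contDiff_dz_of_contDiff h2
    have h4 : ContDiff ℝ 0 (uncurry (dz (dz (Dz^[m] Ψ)))) := contDiff_dz_of_contDiff h3
    exact (continuous_fst.pow 2).mul h4.continuous
  have sdd : ∀ m : ℕ, HasCompactSupport fun p : ℝ × ℝ => p.1 ^ 2 * dz (dz (Dz^[m] Ψ)) p.1 p.2 := fun m =>
    (hasCompactSupport_dz (hasCompactSupport_dz (hasCompactSupport_iterate_Dz hΨs m))).mul_left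
  have pdd : ∀ m : ℕ, ∀ p ∈ tsupport (fun p : ℝ × ℝ => p.1 ^ 2 * dz (dz (Dz^[m] Ψ)) p.1 p.2), 0 < p.1 := by
    intro m p hp
    refine hpos p (hΨsub ((tsupport_iterate_Dz_subset m) (tsupport_dz_subset (tsupport_dz_subset ?_))))
    exact (tsupport_mul_subset_right (f := fun p : ℝ × ℝ => p.1 ^ 2) (g := uncurry (dz (dz (Dz^[m] Ψ))))) hp
  have cdz : ∀ m : ℕ, m ≤ 6 → Continuous fun p : ℝ × ℝ => dz (Dz^[m] Ψ) p.1 p.2 := by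
    intro m hm
    have h2 : ContDiff ℝ 1 (uncurry (Dz^[m] Ψ)) := (regΨj4 m hm).of_le (by norm_num)
    exact (contDiff_dz_of_contDiff (n := 0) h2).continuous
  have sdz : ∀ m : ℕ, HasCompactSupport fun p : ℝ × ℝ => dz (Dz^[m] Ψ) p.1 p.2 := fun m => hasCompactSupport_dz (hasCompactSupport_iterate_Dz hΨs m)
  have pdz : ∀ m : ℕ, ∀ p ∈ tsupport (fun p : ℝ × ℝ => dz (Dz^[m] Ψ) p.1 p.2), 0 < p.1 := fun m p hp =>
    hpos p (hΨsub ((tsupport_iterate_Dz_subset m) (tsupport_dz_subset hp)))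
  -- Step 3 at radial orders 0..4
  obtain ⟨hP0, hZ0, hC0, hR0, hX0, hB0, hY0, hRR0⟩ :=
    polar_singular_apriori_estimate_iterate hα hα4 0 (regχ3 0 (by norm_num)) hs hpos hχ0 hΨ horth
  obtain ⟨hP1, hZ1, hC1, hR1, hX1, hB1, hY1, hRR1⟩ :=
    polar_singular_apriori_estimate_iterate hα hα4 1 (regχ3 1 (by norm_num)) hs hpos hχ0 hΨ horth
  obtain ⟨hP2, hZ2, hC2, hR2, hX2, hB2, hY2, hRR2⟩ :=
    polar_singular_apriori_estimate_iterate hα hα4 2 (regχ3 2 (by norm_num)) hs hpos hχ0 hΨ horth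
  obtain ⟨hP3, hZ3, hC3, hR3, hX3, hB3, hY3, hRR3⟩ :=
    polar_singular_apriori_estimate_iterate hα hα4 3 (regχ3 3 (by norm_num)) hs hpos hχ0 hΨ horth
  obtain ⟨hP4, hZ4, hC4, hR4, hX4, hB4, hY4, hRR4⟩ :=
    polar_singular_apriori_estimate_iterate hα hα4 4 (regχ3 4 (by norm_num)) hs hpos hχ0 hΨ horth
  try simp only [Function.iterate_zero, id_eq] at hP0 hZ0 hC0 hR0 hX0 hB0 hY0 hRR0
  have nnL0 : 0 ≤ (∫ p in strip, radialWeight p.1 ^ 2 * ellipticOp α Ψ p.1 p.2 ^ 2 * Real.sin (2 * p.2) ^ (-eta)) := setIntegral_nonneg measurableSet_strip fun p hp => strip_integrand_nonneg hp _ _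
  have nnL1 : 0 ≤ (∫ p in strip, radialWeight p.1 ^ 2 * (Dz^[1] (ellipticOp α Ψ)) p.1 p.2 ^ 2 * Real.sin (2 * p.2) ^ (-eta)) := setIntegral_nonneg measurableSet_strip fun p hp => strip_integrand_nonneg hp _ _
  have nnL2 : 0 ≤ (∫ p in strip, radialWeight p.1 ^ 2 * (Dz^[2] (ellipticOp α Ψ)) p.1 p.2 ^ 2 * Real.sin (2 * p.2) ^ (-eta)) := setIntegral_nonneg measurableSet_strip fun p hp => strip_integrand_nonneg hp _ _
  have nnL3 : 0 ≤ (∫ p in strip, radialWeight p.1 ^ 2 * (Dz^[3] (ellipticOp α Ψ)) p.1 p.2 ^ 2 * Real.sin (2 * p.2) ^ (-eta)) := setIntegral_nonneg measurableSet_strip fun p hp => strip_integrand_nonneg hp _ _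
  have nnL4 : 0 ≤ (∫ p in strip, radialWeight p.1 ^ 2 * (Dz^[4] (ellipticOp α Ψ)) p.1 p.2 ^ 2 * Real.sin (2 * p.2) ^ (-eta)) := setIntegral_nonneg measurableSet_strip fun p hp => strip_integrand_nonneg hp _ _
  have nnF10 : 0 ≤ (∫ p in strip, radialWeight p.1 ^ 2 * dθ gF p.1 p.2 ^ 2 * Real.sin (2 * p.2) ^ (2 - gammaExp α)) := setIntegral_nonneg measurableSet_strip fun p hp => strip_integrand_nonneg hp _ _
  have nnF11 : 0 ≤ (∫ p in strip, radialWeight p.1 ^ 2 * dθ (Dz^[1] gF) p.1 p.2 ^ 2 * Real.sin (2 * p.2) ^ (2 - gammaExp α)) := setIntegral_nonneg measurableSet_strip fun p hp => strip_integrand_nonneg hp _ _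
  have nnF12 : 0 ≤ (∫ p in strip, radialWeight p.1 ^ 2 * dθ (Dz^[2] gF) p.1 p.2 ^ 2 * Real.sin (2 * p.2) ^ (2 - gammaExp α)) := setIntegral_nonneg measurableSet_strip fun p hp => strip_integrand_nonneg hp _ _
  have nnF13 : 0 ≤ (∫ p in strip, radialWeight p.1 ^ 2 * dθ (Dz^[3] gF) p.1 p.2 ^ 2 * Real.sin (2 * p.2) ^ (2 - gammaExp α)) := setIntegral_nonneg measurableSet_strip fun p hp => strip_integrand_nonneg hp _ _
  have nnF20 : 0 ≤ (∫ p in strip, radialWeight p.1 ^ 2 * dθ (dθ gF) p.1 p.2 ^ 2 * Real.sin (2 * p.2) ^ (4 - gammaExp α)) := setIntegral_nonneg measurableSet_strip fun p hp => strip_integrand_nonneg hp _ _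
  have nnF21 : 0 ≤ (∫ p in strip, radialWeight p.1 ^ 2 * dθ (dθ (Dz^[1] gF)) p.1 p.2 ^ 2 * Real.sin (2 * p.2) ^ (4 - gammaExp α)) := setIntegral_nonneg measurableSet_strip fun p hp => strip_integrand_nonneg hp _ _
  have nnF22 : 0 ≤ (∫ p in strip, radialWeight p.1 ^ 2 * dθ (dθ (Dz^[2] gF)) p.1 p.2 ^ 2 * Real.sin (2 * p.2) ^ (4 - gammaExp α)) := setIntegral_nonneg measurableSet_strip fun p hp => strip_integrand_nonneg hp _ _
  have nnF30 : 0 ≤ (∫ p in strip, radialWeight p.1 ^ 2 * (dθ^[3] gF) p.1 p.2 ^ 2 * Real.sin (2 * p.2) ^ (6 - gammaExp α)) := setIntegral_nonneg measurableSet_strip fun p hp => strip_integrand_nonneg hp _ _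
  have nnF31 : 0 ≤ (∫ p in strip, radialWeight p.1 ^ 2 * (dθ^[3] (Dz^[1] gF)) p.1 p.2 ^ 2 * Real.sin (2 * p.2) ^ (6 - gammaExp α)) := setIntegral_nonneg measurableSet_strip fun p hp => strip_integrand_nonneg hp _ _
  have nnF40 : 0 ≤ (∫ p in strip, radialWeight p.1 ^ 2 * (dθ^[4] gF) p.1 p.2 ^ 2 * Real.sin (2 * p.2) ^ (8 - gammaExp α)) := setIntegral_nonneg measurableSet_strip fun p hp => strip_integrand_nonneg hp _ _
  have dL0 : (∫ p in strip, radialWeight p.1 ^ 2 * ellipticOp α Ψ p.1 p.2 ^ 2 * Real.sin (2 * p.2) ^ (-eta)) ≤ D := by rw [hD]; linarith only [nnL0, nnL1, nnL2, nnL3, nnL4, nnF10, nnF11, nnF12, nnF13, nnF20, nnF21, nnF22, nnF30, nnF31, nnF40]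
  have dL1 : (∫ p in strip, radialWeight p.1 ^ 2 * (Dz^[1] (ellipticOp α Ψ)) p.1 p.2 ^ 2 * Real.sin (2 * p.2) ^ (-eta)) ≤ D := by rw [hD]; linarith only [nnL0, nnL1, nnL2, nnL3, nnL4, nnF10, nnF11, nnF12, nnF13, nnF20, nnF21, nnF22, nnF30, nnF31, nnF40]
  have dL2 : (∫ p in strip, radialWeight p.1 ^ 2 * (Dz^[2] (ellipticOp α Ψ)) p.1 p.2 ^ 2 * Real.sin (2 * p.2) ^ (-eta)) ≤ D := by rw [hD]; linarith only [nnL0, nnL1, nnL2, nnL3, nnL4, nnF10, nnF11, nnF12, nnF13, nnF20, nnF21, nnF22, nnF30, nnF31, nnF40]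
  have dL3 : (∫ p in strip, radialWeight p.1 ^ 2 * (Dz^[3] (ellipticOp α Ψ)) p.1 p.2 ^ 2 * Real.sin (2 * p.2) ^ (-eta)) ≤ D := by rw [hD]; linarith only [nnL0, nnL1, nnL2, nnL3, nnL4, nnF10, nnF11, nnF12, nnF13, nnF20, nnF21, nnF22, nnF30, nnF31, nnF40]
  have dL4 : (∫ p in strip, radialWeight p.1 ^ 2 * (Dz^[4] (ellipticOp α Ψ)) p.1 p.2 ^ 2 * Real.sin (2 * p.2) ^ (-eta)) ≤ D := by rw [hD]; linarith only [nnL0, nnL1, nnL2, nnL3, nnL4, nnF10, nnF11, nnF12, nnF13, nnF20, nnF21, nnF22, nnF30, nnF31, nnF40]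
  have hD0 : 0 ≤ D := by rw [hD]; linarith only [nnL0, nnL1, nnL2, nnL3, nnL4, nnF10, nnF11, nnF12, nnF13, nnF20, nnF21, nnF22, nnF30, nnF31, nnF40]
  have hr0_1 : (0:ℝ) ≤ 2 - gammaExp α := by linarith
  have hr0_2 : (0:ℝ) ≤ 4 - gammaExp α := by linarith
  have hr0_3 : (0:ℝ) ≤ 6 - gammaExp α := by linarith
  have hr0_4 : (0:ℝ) ≤ 8 - gammaExp α := by linarith
  have nnN10 : 0 ≤ (∫ p in strip, radialWeight p.1 ^ 2 * dθ (dθ χ) p.1 p.2 ^ 2 * Real.sin (2 * p.2) ^ (2 - gammaExp α)) := setIntegral_nonneg measurableSet_strip fun p hp => strip_integrand_nonneg hp _ _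
  have bM10 : (∫ p in strip, radialWeight p.1 ^ 2 * (dθ^[3] Ψ) p.1 p.2 ^ 2 * Real.sin (2 * p.2) ^ (2 - gammaExp α)) ≤ 200000000 * D := by linarith only [res10, nnN10]
  have nnN11 : 0 ≤ (∫ p in strip, radialWeight p.1 ^ 2 * dθ (dθ (Dz^[1] χ)) p.1 p.2 ^ 2 * Real.sin (2 * p.2) ^ (2 - gammaExp α)) := setIntegral_nonneg measurableSet_strip fun p hp => strip_integrand_nonneg hp _ _
  have bM11 : (∫ p in strip, radialWeight p.1 ^ 2 * (dθ^[3] (Dz^[1] Ψ)) p.1 p.2 ^ 2 * Real.sin (2 * p.2) ^ (2 - gammaExp α)) ≤ 200000000 * D := by linarith only [res11, nnN11]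
  have nnN12 : 0 ≤ (∫ p in strip, radialWeight p.1 ^ 2 * dθ (dθ (Dz^[2] χ)) p.1 p.2 ^ 2 * Real.sin (2 * p.2) ^ (2 - gammaExp α)) := setIntegral_nonneg measurableSet_strip fun p hp => strip_integrand_nonneg hp _ _
  have bM12 : (∫ p in strip, radialWeight p.1 ^ 2 * (dθ^[3] (Dz^[2] Ψ)) p.1 p.2 ^ 2 * Real.sin (2 * p.2) ^ (2 - gammaExp α)) ≤ 200000000 * D := by linarith only [res12, nnN12]
  have nnN13 : 0 ≤ (∫ p in strip, radialWeight p.1 ^ 2 * dθ (dθ (Dz^[3] χ)) p.1 p.2 ^ 2 * Real.sin (2 * p.2) ^ (2 - gammaExp α)) := setIntegral_nonneg measurableSet_strip fun p hp => strip_integrand_nonneg hp _ _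
  have bM13 : (∫ p in strip, radialWeight p.1 ^ 2 * (dθ^[3] (Dz^[3] Ψ)) p.1 p.2 ^ 2 * Real.sin (2 * p.2) ^ (2 - gammaExp α)) ≤ 200000000 * D := by linarith only [res13, nnN13]
  have nnN20 : 0 ≤ (∫ p in strip, radialWeight p.1 ^ 2 * (dθ^[3] χ) p.1 p.2 ^ 2 * Real.sin (2 * p.2) ^ (4 - gammaExp α)) := setIntegral_nonneg measurableSet_strip fun p hp => strip_integrand_nonneg hp _ _
  have bM20 : (∫ p in strip, radialWeight p.1 ^ 2 * (dθ^[4] Ψ) p.1 p.2 ^ 2 * Real.sin (2 * p.2) ^ (4 - gammaExp α)) ≤ 3000000000000 * D := by linarith only [res20, nnN20]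
  have nnN21 : 0 ≤ (∫ p in strip, radialWeight p.1 ^ 2 * (dθ^[3] (Dz^[1] χ)) p.1 p.2 ^ 2 * Real.sin (2 * p.2) ^ (4 - gammaExp α)) := setIntegral_nonneg measurableSet_strip fun p hp => strip_integrand_nonneg hp _ _
  have bM21 : (∫ p in strip, radialWeight p.1 ^ 2 * (dθ^[4] (Dz^[1] Ψ)) p.1 p.2 ^ 2 * Real.sin (2 * p.2) ^ (4 - gammaExp α)) ≤ 3000000000000 * D := by linarith only [res21, nnN21]
  have nnN22 : 0 ≤ (∫ p in strip, radialWeight p.1 ^ 2 * (dθ^[3] (Dz^[2] χ)) p.1 p.2 ^ 2 * Real.sin (2 * p.2) ^ (4 - gammaExp α)) := setIntegral_nonneg measurableSet_strip fun p hp => strip_integrand_nonneg hp _ _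
  have bM22 : (∫ p in strip, radialWeight p.1 ^ 2 * (dθ^[4] (Dz^[2] Ψ)) p.1 p.2 ^ 2 * Real.sin (2 * p.2) ^ (4 - gammaExp α)) ≤ 3000000000000 * D := by linarith only [res22, nnN22]
  have nnN30 : 0 ≤ (∫ p in strip, radialWeight p.1 ^ 2 * (dθ^[4] χ) p.1 p.2 ^ 2 * Real.sin (2 * p.2) ^ (6 - gammaExp α)) := setIntegral_nonneg measurableSet_strip fun p hp => strip_integrand_nonneg hp _ _
  have bM30 : (∫ p in strip, radialWeight p.1 ^ 2 * (dθ^[5] Ψ) p.1 p.2 ^ 2 * Real.sin (2 * p.2) ^ (6 - gammaExp α)) ≤ 200000000000000000 * D := by linarith only [res30, nnN30]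
  have nnN31 : 0 ≤ (∫ p in strip, radialWeight p.1 ^ 2 * (dθ^[4] (Dz^[1] χ)) p.1 p.2 ^ 2 * Real.sin (2 * p.2) ^ (6 - gammaExp α)) := setIntegral_nonneg measurableSet_strip fun p hp => strip_integrand_nonneg hp _ _
  have bM31 : (∫ p in strip, radialWeight p.1 ^ 2 * (dθ^[5] (Dz^[1] Ψ)) p.1 p.2 ^ 2 * Real.sin (2 * p.2) ^ (6 - gammaExp α)) ≤ 200000000000000000 * D := by linarith only [res31, nnN31]
  have nnN40 : 0 ≤ (∫ p in strip, radialWeight p.1 ^ 2 * (dθ^[5] χ) p.1 p.2 ^ 2 * Real.sin (2 * p.2) ^ (8 - gammaExp α)) := setIntegral_nonneg measurableSet_strip fun p hp => strip_integrand_nonneg hp _ _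
  have bM40 : (∫ p in strip, radialWeight p.1 ^ 2 * (dθ^[6] Ψ) p.1 p.2 ^ 2 * Real.sin (2 * p.2) ^ (8 - gammaExp α)) ≤ 70000000000000000000000 * D := by linarith only [res40, nnN40]
  -- integrability of the standard integrands
  have iRpow : ∀ {X : ℝ × ℝ → ℝ}, Continuous X → HasCompactSupport X → (∀ p ∈ tsupport X, 0 < p.1) → ∀ {r : ℝ}, 0 ≤ r →
      IntegrableOn (fun p : ℝ × ℝ => radialWeight p.1 ^ 2 * X p ^ 2 * Real.sin (2 * p.2) ^ r) strip := by
    intro X hX hXs hXp r hr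
    have hs2 : HasCompactSupport fun p => X p ^ 2 := hasCompactSupport_of_eq_zero hXs fun p hp => by simp [hp]
    have hp2 : ∀ p ∈ tsupport (fun p => X p ^ 2), 0 < p.1 := fun p hp =>
      hXp p (tsupport_subset_of_eq_zero (X := X) (fun q hq => by simp [hq]) hp)
    exact (integrable_weight_mul_rpow hWc (by fun_prop) hs2 hp2 hr).integrableOn
  have iSing : ∀ {X : ℝ × ℝ → ℝ}, Continuous X → HasCompactSupport X → (∀ p ∈ tsupport X, 0 < p.1) →
      IntegrableOn (fun p : ℝ × ℝ => radialWeight p.1 ^ 2 * X p ^ 2 * Real.sin (2 * p.2) ^ (-eta)) strip := by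
    intro X hX hXs hXp
    have hs2 : HasCompactSupport fun p => X p ^ 2 := hasCompactSupport_of_eq_zero hXs fun p hp => by simp [hp]
    have hp2 : ∀ p ∈ tsupport (fun p => X p ^ 2), 0 < p.1 := fun p hp =>
      hXp p (tsupport_subset_of_eq_zero (X := X) (fun q hq => by simp [hq]) hp)
    obtain ⟨a, ha, hva⟩ := exists_pos_forall_fst_lt_eq_zero hs2 hp2
    have hc : Continuous fun p : ℝ × ℝ => radialWeight p.1 ^ 2 * X p ^ 2 := continuous_weight_mul₂ hWc (by fun_prop) ha hva
    have hcs : HasCompactSupport fun p : ℝ × ℝ => radialWeight p.1 ^ 2 * X p ^ 2 := hasCompactSupport_of_eq_zero hs2 fun p hp => by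
      show radialWeight p.1 ^ 2 * X p ^ 2 = 0
      rw [show X p ^ 2 = 0 from hp, mul_zero]
    exact integrableOn_strip_mul_rpow_of_continuous eta_pos.le (by norm_num [eta]) hc hcs
  have iZ : ∀ {X : ℝ × ℝ → ℝ}, Continuous X → HasCompactSupport X → (∀ p ∈ tsupport X, 0 < p.1) →
      IntegrableOn (fun p : ℝ × ℝ => p.1 ^ 2 * radialWeight p.1 ^ 2 * X p ^ 2 * Real.sin (2 * p.2) ^ (-eta)) strip := by
    intro X hX hXs hXp
    have h := iSing (X := fun p => p.1 * X p) (by fun_prop) hXs.mul_left fun p hp =>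
      hXp p ((tsupport_mul_subset_right (f := fun p : ℝ × ℝ => p.1) (g := X)) hp)
    refine h.congr_fun (fun p _ => by ring) measurableSet_strip
  have i0 : IntegrableOn (fun _ : ℝ × ℝ => (0 : ℝ)) strip := integrableOn_zero
  have nn0 : ∀ p ∈ strip, (0 : ℝ) ≤ (fun _ : ℝ × ℝ => (0 : ℝ)) p := fun p _ => le_rfl
  have z0 : (∫ p in strip, (fun _ : ℝ × ℝ => (0 : ℝ)) p) = 0 := by simp
  have nnW : ∀ p ∈ strip, ∀ (a r : ℝ), 0 ≤ radialWeight p.1 ^ 2 * a ^ 2 * Real.sin (2 * p.2) ^ r := fun p hp a r => strip_integrand_nonneg hp a r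
  have nnZ : ∀ p ∈ strip, ∀ (a r : ℝ), 0 ≤ p.1 ^ 2 * radialWeight p.1 ^ 2 * a ^ 2 * Real.sin (2 * p.2) ^ r := fun p hp a r => strip_integrand_nonneg' hp a r
  have idR2_0 : ∀ q : ℝ × ℝ, (Dz^[0] (Dz Ψ)) q.1 q.2 = q.1 * dz Ψ q.1 q.2 := fun q => by
    rw [← Function.iterate_succ_apply, Function.iterate_succ_apply' Dz 0 Ψ, Dz_eq_mul_dz]
    try simp only [Function.iterate_zero, id_eq]
  try simp only [Nat.reduceAdd, Nat.reduceMul, Nat.reducePow, Nat.cast_one, Nat.cast_ofNat, Finset.sum_range_succ, Finset.sum_range_zero, zero_add, Function.iterate_zero, id_eq, iterate_dθ_one, iterate_dθ_two] at idR2_0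
  ----------------------------------------------------------------
  -- f2: radial term 0
  have t_f2_r0 : eL2Sq (hkRadialTerm 0 (α • Dz Ψ)) ≤ ENNReal.ofReal (α ^ 2 * (∫ p in strip, (fun p : ℝ × ℝ => p.1 ^ 2 * radialWeight p.1 ^ 2 * dz Ψ p.1 p.2 ^ 2 * Real.sin (2 * p.2) ^ (-eta)) p) + 0 * (∫ p in strip, (fun _ : ℝ × ℝ => (0 : ℝ)) p) +
      0 * (∫ p in strip, (fun _ : ℝ × ℝ => (0 : ℝ)) p) + 0 * ∫ p in strip, (fun _ : ℝ × ℝ => (0 : ℝ)) p) := by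
    refine eL2Sq_le_ofReal_add4 (H₁ := (fun p : ℝ × ℝ => p.1 ^ 2 * radialWeight p.1 ^ 2 * dz Ψ p.1 p.2 ^ 2 * Real.sin (2 * p.2) ^ (-eta))) (H₂ := (fun _ : ℝ × ℝ => (0 : ℝ))) (H₃ := (fun _ : ℝ × ℝ => (0 : ℝ))) (H₄ := (fun _ : ℝ × ℝ => (0 : ℝ)))
      (by positivity) (by positivity) (by positivity) (by positivity) (iZ (cdz 0 (by norm_num)) (sdz 0) (pdz 0)) i0 i0 i0
      (fun p hp => nnZ p hp _ _) nn0 nn0 nn0 fun p hp => ?_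
    show (hkRadialTerm 0 (α • Dz Ψ) p.1 p.2) ^ 2 ≤ α ^ 2 * (p.1 ^ 2 * radialWeight p.1 ^ 2 * dz Ψ p.1 p.2 ^ 2 * Real.sin (2 * p.2) ^ (-eta)) + 0 * ((0:ℝ)) + 0 * ((0:ℝ)) + 0 * ((0:ℝ))
    rw [hkRadialTerm_smul]
    simp only [Pi.smul_apply, smul_eq_mul]
    rw [mul_pow, sq_hkRadialTerm 0 _ hp]
    try simp only [Nat.reduceAdd, Nat.reduceMul, Nat.reducePow, Nat.cast_one, Nat.cast_ofNat, Finset.sum_range_succ, Finset.sum_range_zero, zero_add, Function.iterate_zero, id_eq, iterate_dθ_one, iterate_dθ_two]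
    rw [idR2_0 p]
    apply le_of_eq
    ring
  have b_f2_r0 : eL2Sq (hkRadialTerm 0 (α • Dz Ψ)) ≤ ENNReal.ofReal (300000000000000000000000 * D) := by
    refine t_f2_r0.trans (ENNReal.ofReal_le_ofReal ?_)
    simp only [z0]
    linarith only [hR0, dL0, hD0, hα20, hα40, hα2, hα4']
  have idR2_1 : ∀ q : ℝ × ℝ, (Dz^[1] (Dz Ψ)) q.1 q.2 = q.1 * dz (Dz^[1] Ψ) q.1 q.2 := fun q => by
    rw [← Function.iterate_succ_apply, Function.iterate_succ_apply' Dz 1 Ψ, Dz_eq_mul_dz]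
    try simp only [Function.iterate_zero, id_eq]
  try simp only [Nat.reduceAdd, Nat.reduceMul, Nat.reducePow, Nat.cast_one, Nat.cast_ofNat, Finset.sum_range_succ, Finset.sum_range_zero, zero_add, Function.iterate_zero, id_eq, iterate_dθ_one, iterate_dθ_two] at idR2_1
  ----------------------------------------------------------------
  -- f2: radial term 1
  have t_f2_r1 : eL2Sq (hkRadialTerm 1 (α • Dz Ψ)) ≤ ENNReal.ofReal (α ^ 2 * (∫ p in strip, (fun p : ℝ × ℝ => p.1 ^ 2 * radialWeight p.1 ^ 2 * dz (Dz^[1] Ψ) p.1 p.2 ^ 2 * Real.sin (2 * p.2) ^ (-eta)) p) + 0 * (∫ p in strip, (fun _ : ℝ × ℝ => (0 : ℝ)) p) +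
      0 * (∫ p in strip, (fun _ : ℝ × ℝ => (0 : ℝ)) p) + 0 * ∫ p in strip, (fun _ : ℝ × ℝ => (0 : ℝ)) p) := by
    refine eL2Sq_le_ofReal_add4 (H₁ := (fun p : ℝ × ℝ => p.1 ^ 2 * radialWeight p.1 ^ 2 * dz (Dz^[1] Ψ) p.1 p.2 ^ 2 * Real.sin (2 * p.2) ^ (-eta))) (H₂ := (fun _ : ℝ × ℝ => (0 : ℝ))) (H₃ := (fun _ : ℝ × ℝ => (0 : ℝ))) (H₄ := (fun _ : ℝ × ℝ => (0 : ℝ)))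
      (by positivity) (by positivity) (by positivity) (by positivity) (iZ (cdz 1 (by norm_num)) (sdz 1) (pdz 1)) i0 i0 i0
      (fun p hp => nnZ p hp _ _) nn0 nn0 nn0 fun p hp => ?_
    show (hkRadialTerm 1 (α • Dz Ψ) p.1 p.2) ^ 2 ≤ α ^ 2 * (p.1 ^ 2 * radialWeight p.1 ^ 2 * dz (Dz^[1] Ψ) p.1 p.2 ^ 2 * Real.sin (2 * p.2) ^ (-eta)) + 0 * ((0:ℝ)) + 0 * ((0:ℝ)) + 0 * ((0:ℝ))
    rw [hkRadialTerm_smul]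
    simp only [Pi.smul_apply, smul_eq_mul]
    rw [mul_pow, sq_hkRadialTerm 1 _ hp]
    try simp only [Nat.reduceAdd, Nat.reduceMul, Nat.reducePow, Nat.cast_one, Nat.cast_ofNat, Finset.sum_range_succ, Finset.sum_range_zero, zero_add, Function.iterate_zero, id_eq, iterate_dθ_one, iterate_dθ_two]
    rw [idR2_1 p]
    apply le_of_eq
    ring
  have b_f2_r1 : eL2Sq (hkRadialTerm 1 (α • Dz Ψ)) ≤ ENNReal.ofReal (300000000000000000000000 * D) := by
    refine t_f2_r1.trans (ENNReal.ofReal_le_ofReal ?_)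
    simp only [z0]
    linarith only [hR1, dL1, hD0, hα20, hα40, hα2, hα4']
  have idR2_2 : ∀ q : ℝ × ℝ, (Dz^[2] (Dz Ψ)) q.1 q.2 = q.1 * dz (Dz^[2] Ψ) q.1 q.2 := fun q => by
    rw [← Function.iterate_succ_apply, Function.iterate_succ_apply' Dz 2 Ψ, Dz_eq_mul_dz]
    try simp only [Function.iterate_zero, id_eq]
  try simp only [Nat.reduceAdd, Nat.reduceMul, Nat.reducePow, Nat.cast_one, Nat.cast_ofNat, Finset.sum_range_succ, Finset.sum_range_zero, zero_add, Function.iterate_zero, id_eq, iterate_dθ_one, iterate_dθ_two] at idR2_2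
  ----------------------------------------------------------------
  -- f2: radial term 2
  have t_f2_r2 : eL2Sq (hkRadialTerm 2 (α • Dz Ψ)) ≤ ENNReal.ofReal (α ^ 2 * (∫ p in strip, (fun p : ℝ × ℝ => p.1 ^ 2 * radialWeight p.1 ^ 2 * dz (Dz^[2] Ψ) p.1 p.2 ^ 2 * Real.sin (2 * p.2) ^ (-eta)) p) + 0 * (∫ p in strip, (fun _ : ℝ × ℝ => (0 : ℝ)) p) +
      0 * (∫ p in strip, (fun _ : ℝ × ℝ => (0 : ℝ)) p) + 0 * ∫ p in strip, (fun _ : ℝ × ℝ => (0 : ℝ)) p) := by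
    refine eL2Sq_le_ofReal_add4 (H₁ := (fun p : ℝ × ℝ => p.1 ^ 2 * radialWeight p.1 ^ 2 * dz (Dz^[2] Ψ) p.1 p.2 ^ 2 * Real.sin (2 * p.2) ^ (-eta))) (H₂ := (fun _ : ℝ × ℝ => (0 : ℝ))) (H₃ := (fun _ : ℝ × ℝ => (0 : ℝ))) (H₄ := (fun _ : ℝ × ℝ => (0 : ℝ)))
      (by positivity) (by positivity) (by positivity) (by positivity) (iZ (cdz 2 (by norm_num)) (sdz 2) (pdz 2)) i0 i0 i0
      (fun p hp => nnZ p hp _ _) nn0 nn0 nn0 fun p hp => ?_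
    show (hkRadialTerm 2 (α • Dz Ψ) p.1 p.2) ^ 2 ≤ α ^ 2 * (p.1 ^ 2 * radialWeight p.1 ^ 2 * dz (Dz^[2] Ψ) p.1 p.2 ^ 2 * Real.sin (2 * p.2) ^ (-eta)) + 0 * ((0:ℝ)) + 0 * ((0:ℝ)) + 0 * ((0:ℝ))
    rw [hkRadialTerm_smul]
    simp only [Pi.smul_apply, smul_eq_mul]
    rw [mul_pow, sq_hkRadialTerm 2 _ hp]
    try simp only [Nat.reduceAdd, Nat.reduceMul, Nat.reducePow, Nat.cast_one, Nat.cast_ofNat, Finset.sum_range_succ, Finset.sum_range_zero, zero_add, Function.iterate_zero, id_eq, iterate_dθ_one, iterate_dθ_two]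
    rw [idR2_2 p]
    apply le_of_eq
    ring
  have b_f2_r2 : eL2Sq (hkRadialTerm 2 (α • Dz Ψ)) ≤ ENNReal.ofReal (300000000000000000000000 * D) := by
    refine t_f2_r2.trans (ENNReal.ofReal_le_ofReal ?_)
    simp only [z0]
    linarith only [hR2, dL2, hD0, hα20, hα40, hα2, hα4']
  have idR2_3 : ∀ q : ℝ × ℝ, (Dz^[3] (Dz Ψ)) q.1 q.2 = q.1 * dz (Dz^[3] Ψ) q.1 q.2 := fun q => by
    rw [← Function.iterate_succ_apply, Function.iterate_succ_apply' Dz 3 Ψ, Dz_eq_mul_dz]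
    try simp only [Function.iterate_zero, id_eq]
  try simp only [Nat.reduceAdd, Nat.reduceMul, Nat.reducePow, Nat.cast_one, Nat.cast_ofNat, Finset.sum_range_succ, Finset.sum_range_zero, zero_add, Function.iterate_zero, id_eq, iterate_dθ_one, iterate_dθ_two] at idR2_3
  ----------------------------------------------------------------
  -- f2: radial term 3
  have t_f2_r3 : eL2Sq (hkRadialTerm 3 (α • Dz Ψ)) ≤ ENNReal.ofReal (α ^ 2 * (∫ p in strip, (fun p : ℝ × ℝ => p.1 ^ 2 * radialWeight p.1 ^ 2 * dz (Dz^[3] Ψ) p.1 p.2 ^ 2 * Real.sin (2 * p.2) ^ (-eta)) p) + 0 * (∫ p in strip, (fun _ : ℝ × ℝ => (0 : ℝ)) p) +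
      0 * (∫ p in strip, (fun _ : ℝ × ℝ => (0 : ℝ)) p) + 0 * ∫ p in strip, (fun _ : ℝ × ℝ => (0 : ℝ)) p) := by
    refine eL2Sq_le_ofReal_add4 (H₁ := (fun p : ℝ × ℝ => p.1 ^ 2 * radialWeight p.1 ^ 2 * dz (Dz^[3] Ψ) p.1 p.2 ^ 2 * Real.sin (2 * p.2) ^ (-eta))) (H₂ := (fun _ : ℝ × ℝ => (0 : ℝ))) (H₃ := (fun _ : ℝ × ℝ => (0 : ℝ))) (H₄ := (fun _ : ℝ × ℝ => (0 : ℝ)))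
      (by positivity) (by positivity) (by positivity) (by positivity) (iZ (cdz 3 (by norm_num)) (sdz 3) (pdz 3)) i0 i0 i0
      (fun p hp => nnZ p hp _ _) nn0 nn0 nn0 fun p hp => ?_
    show (hkRadialTerm 3 (α • Dz Ψ) p.1 p.2) ^ 2 ≤ α ^ 2 * (p.1 ^ 2 * radialWeight p.1 ^ 2 * dz (Dz^[3] Ψ) p.1 p.2 ^ 2 * Real.sin (2 * p.2) ^ (-eta)) + 0 * ((0:ℝ)) + 0 * ((0:ℝ)) + 0 * ((0:ℝ))
    rw [hkRadialTerm_smul]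
    simp only [Pi.smul_apply, smul_eq_mul]
    rw [mul_pow, sq_hkRadialTerm 3 _ hp]
    try simp only [Nat.reduceAdd, Nat.reduceMul, Nat.reducePow, Nat.cast_one, Nat.cast_ofNat, Finset.sum_range_succ, Finset.sum_range_zero, zero_add, Function.iterate_zero, id_eq, iterate_dθ_one, iterate_dθ_two]
    rw [idR2_3 p]
    apply le_of_eq
    ring
  have b_f2_r3 : eL2Sq (hkRadialTerm 3 (α • Dz Ψ)) ≤ ENNReal.ofReal (300000000000000000000000 * D) := by
    refine t_f2_r3.trans (ENNReal.ofReal_le_ofReal ?_)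
    simp only [z0]
    linarith only [hR3, dL3, hD0, hα20, hα40, hα2, hα4']
  have idR2_4 : ∀ q : ℝ × ℝ, (Dz^[4] (Dz Ψ)) q.1 q.2 = q.1 * dz (Dz^[4] Ψ) q.1 q.2 := fun q => by
    rw [← Function.iterate_succ_apply, Function.iterate_succ_apply' Dz 4 Ψ, Dz_eq_mul_dz]
    try simp only [Function.iterate_zero, id_eq]
  try simp only [Nat.reduceAdd, Nat.reduceMul, Nat.reducePow, Nat.cast_one, Nat.cast_ofNat, Finset.sum_range_succ, Finset.sum_range_zero, zero_add, Function.iterate_zero, id_eq, iterate_dθ_one, iterate_dθ_two] at idR2_4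
  ----------------------------------------------------------------
  -- f2: radial term 4
  have t_f2_r4 : eL2Sq (hkRadialTerm 4 (α • Dz Ψ)) ≤ ENNReal.ofReal (α ^ 2 * (∫ p in strip, (fun p : ℝ × ℝ => p.1 ^ 2 * radialWeight p.1 ^ 2 * dz (Dz^[4] Ψ) p.1 p.2 ^ 2 * Real.sin (2 * p.2) ^ (-eta)) p) + 0 * (∫ p in strip, (fun _ : ℝ × ℝ => (0 : ℝ)) p) +
      0 * (∫ p in strip, (fun _ : ℝ × ℝ => (0 : ℝ)) p) + 0 * ∫ p in strip, (fun _ : ℝ × ℝ => (0 : ℝ)) p) := by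
    refine eL2Sq_le_ofReal_add4 (H₁ := (fun p : ℝ × ℝ => p.1 ^ 2 * radialWeight p.1 ^ 2 * dz (Dz^[4] Ψ) p.1 p.2 ^ 2 * Real.sin (2 * p.2) ^ (-eta))) (H₂ := (fun _ : ℝ × ℝ => (0 : ℝ))) (H₃ := (fun _ : ℝ × ℝ => (0 : ℝ))) (H₄ := (fun _ : ℝ × ℝ => (0 : ℝ)))
      (by positivity) (by positivity) (by positivity) (by positivity) (iZ (cdz 4 (by norm_num)) (sdz 4) (pdz 4)) i0 i0 i0
      (fun p hp => nnZ p hp _ _) nn0 nn0 nn0 fun p hp => ?_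
    show (hkRadialTerm 4 (α • Dz Ψ) p.1 p.2) ^ 2 ≤ α ^ 2 * (p.1 ^ 2 * radialWeight p.1 ^ 2 * dz (Dz^[4] Ψ) p.1 p.2 ^ 2 * Real.sin (2 * p.2) ^ (-eta)) + 0 * ((0:ℝ)) + 0 * ((0:ℝ)) + 0 * ((0:ℝ))
    rw [hkRadialTerm_smul]
    simp only [Pi.smul_apply, smul_eq_mul]
    rw [mul_pow, sq_hkRadialTerm 4 _ hp]
    try simp only [Nat.reduceAdd, Nat.reduceMul, Nat.reducePow, Nat.cast_one, Nat.cast_ofNat, Finset.sum_range_succ, Finset.sum_range_zero, zero_add, Function.iterate_zero, id_eq, iterate_dθ_one, iterate_dθ_two]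
    rw [idR2_4 p]
    apply le_of_eq
    ring
  have b_f2_r4 : eL2Sq (hkRadialTerm 4 (α • Dz Ψ)) ≤ ENNReal.ofReal (300000000000000000000000 * D) := by
    refine t_f2_r4.trans (ENNReal.ofReal_le_ofReal ?_)
    simp only [z0]
    linarith only [hR4, dL4, hD0, hα20, hα40, hα2, hα4']
  have w1_f2_10 := integral_weight_rpow_le_singular hWc hW0 (cΨ 1 1 (by norm_num)) (sΨ 1 1) (pΨ 1 1) hr0_1
  try simp only [Nat.reduceAdd, Nat.reduceMul, Nat.reducePow, Nat.cast_one, Nat.cast_ofNat, Finset.sum_range_succ, Finset.sum_range_zero, zero_add, Function.iterate_zero, id_eq, iterate_dθ_one, iterate_dθ_two] at w1_f2_10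
  have nH1_f2_10 : 0 ≤ ∫ p in strip, radialWeight p.1 ^ 2 * dθ (Dz^[1] Ψ) p.1 p.2 ^ 2 * Real.sin (2 * p.2) ^ (2 - gammaExp α) := setIntegral_nonneg measurableSet_strip fun p hp => nnW p hp _ _
  have aH1_f2_10 : α ^ 2 * 1 * (∫ p in strip, radialWeight p.1 ^ 2 * dθ (Dz^[1] Ψ) p.1 p.2 ^ 2 * Real.sin (2 * p.2) ^ (2 - gammaExp α)) ≤ 1 * 1 * ∫ p in strip, radialWeight p.1 ^ 2 * dθ (Dz^[1] Ψ) p.1 p.2 ^ 2 * Real.sin (2 * p.2) ^ (2 - gammaExp α) :=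
    mul_le_mul_of_nonneg_right (mul_le_mul_of_nonneg_right hα2 (by norm_num)) nH1_f2_10
  ----------------------------------------------------------------
  -- f2: mixed term (1, 0)
  have t_f2_m10 : eL2Sq (hkMixedTerm α 1 0 (α • Dz Ψ)) ≤ ENNReal.ofReal (α ^ 2 * 1 * (∫ p in strip, (fun p : ℝ × ℝ => radialWeight p.1 ^ 2 * dθ (Dz^[1] Ψ) p.1 p.2 ^ 2 * Real.sin (2 * p.2) ^ (2 - gammaExp α)) p) + 0 * (∫ p in strip, (fun _ : ℝ × ℝ => (0 : ℝ)) p) +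
      0 * (∫ p in strip, (fun _ : ℝ × ℝ => (0 : ℝ)) p) + 0 * ∫ p in strip, (fun _ : ℝ × ℝ => (0 : ℝ)) p) := by
    refine eL2Sq_le_ofReal_add4 (H₁ := (fun p : ℝ × ℝ => radialWeight p.1 ^ 2 * dθ (Dz^[1] Ψ) p.1 p.2 ^ 2 * Real.sin (2 * p.2) ^ (2 - gammaExp α))) (H₂ := (fun _ : ℝ × ℝ => (0 : ℝ))) (H₃ := (fun _ : ℝ × ℝ => (0 : ℝ))) (H₄ := (fun _ : ℝ × ℝ => (0 : ℝ)))
      (by positivity) (by positivity) (by positivity) (by positivity) (iRpow (cΨ 1 1 (by norm_num)) (sΨ 1 1) (pΨ 1 1) hr0_1) i0 i0 i0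
      (fun p hp => nnW p hp _ _) nn0 nn0 nn0 fun p hp => ?_
    show (hkMixedTerm α 1 0 (α • Dz Ψ) p.1 p.2) ^ 2 ≤ α ^ 2 * 1 * (radialWeight p.1 ^ 2 * dθ (Dz^[1] Ψ) p.1 p.2 ^ 2 * Real.sin (2 * p.2) ^ (2 - gammaExp α)) + 0 * ((0:ℝ)) + 0 * ((0:ℝ)) + 0 * ((0:ℝ))
    rw [hkMixedTerm_smul]
    simp only [Pi.smul_apply, smul_eq_mul]
    rw [mul_pow, sq_hkMixedTerm α 1 0 _ hp, ← Function.iterate_succ_apply Dz 0 Ψ]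
    try simp only [Nat.reduceAdd, Nat.reduceMul, Nat.reducePow, Nat.cast_one, Nat.cast_ofNat, Finset.sum_range_succ, Finset.sum_range_zero, zero_add, Function.iterate_zero, id_eq, iterate_dθ_one, iterate_dθ_two]
    have u := up_one (regΨj4 1 (by norm_num)) (gammaExp α) hp
    try simp only [Nat.reduceAdd, Nat.reduceMul, Nat.reducePow, Nat.cast_one, Nat.cast_ofNat, Finset.sum_range_succ, Finset.sum_range_zero, zero_add, Function.iterate_zero, id_eq, iterate_dθ_one, iterate_dθ_two] at u
    have u' := mul_le_mul_of_nonneg_left u hα20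
    linarith only [u']
  have b_f2_m10 : eL2Sq (hkMixedTerm α 1 0 (α • Dz Ψ)) ≤ ENNReal.ofReal (300000000000000000000000 * D) := by
    refine t_f2_m10.trans (ENNReal.ofReal_le_ofReal ?_)
    simp only [z0]
    linarith only [w1_f2_10, hY1, dL1, nH1_f2_10, aH1_f2_10, hD0, hα20, hα40, hα2, hα4']
  have w1_f2_11 := integral_weight_rpow_le_singular hWc hW0 (cΨ 1 2 (by norm_num)) (sΨ 1 2) (pΨ 1 2) hr0_1
  try simp only [Nat.reduceAdd, Nat.reduceMul, Nat.reducePow, Nat.cast_one, Nat.cast_ofNat, Finset.sum_range_succ, Finset.sum_range_zero, zero_add, Function.iterate_zero, id_eq, iterate_dθ_one, iterate_dθ_two] at w1_f2_11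
  have nH1_f2_11 : 0 ≤ ∫ p in strip, radialWeight p.1 ^ 2 * dθ (Dz^[2] Ψ) p.1 p.2 ^ 2 * Real.sin (2 * p.2) ^ (2 - gammaExp α) := setIntegral_nonneg measurableSet_strip fun p hp => nnW p hp _ _
  have aH1_f2_11 : α ^ 2 * 1 * (∫ p in strip, radialWeight p.1 ^ 2 * dθ (Dz^[2] Ψ) p.1 p.2 ^ 2 * Real.sin (2 * p.2) ^ (2 - gammaExp α)) ≤ 1 * 1 * ∫ p in strip, radialWeight p.1 ^ 2 * dθ (Dz^[2] Ψ) p.1 p.2 ^ 2 * Real.sin (2 * p.2) ^ (2 - gammaExp α) :=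
    mul_le_mul_of_nonneg_right (mul_le_mul_of_nonneg_right hα2 (by norm_num)) nH1_f2_11
  ----------------------------------------------------------------
  -- f2: mixed term (1, 1)
  have t_f2_m11 : eL2Sq (hkMixedTerm α 1 1 (α • Dz Ψ)) ≤ ENNReal.ofReal (α ^ 2 * 1 * (∫ p in strip, (fun p : ℝ × ℝ => radialWeight p.1 ^ 2 * dθ (Dz^[2] Ψ) p.1 p.2 ^ 2 * Real.sin (2 * p.2) ^ (2 - gammaExp α)) p) + 0 * (∫ p in strip, (fun _ : ℝ × ℝ => (0 : ℝ)) p) +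
      0 * (∫ p in strip, (fun _ : ℝ × ℝ => (0 : ℝ)) p) + 0 * ∫ p in strip, (fun _ : ℝ × ℝ => (0 : ℝ)) p) := by
    refine eL2Sq_le_ofReal_add4 (H₁ := (fun p : ℝ × ℝ => radialWeight p.1 ^ 2 * dθ (Dz^[2] Ψ) p.1 p.2 ^ 2 * Real.sin (2 * p.2) ^ (2 - gammaExp α))) (H₂ := (fun _ : ℝ × ℝ => (0 : ℝ))) (H₃ := (fun _ : ℝ × ℝ => (0 : ℝ))) (H₄ := (fun _ : ℝ × ℝ => (0 : ℝ)))
      (by positivity) (by positivity) (by positivity) (by positivity) (iRpow (cΨ 1 2 (by norm_num)) (sΨ 1 2) (pΨ 1 2) hr0_1) i0 i0 i0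
      (fun p hp => nnW p hp _ _) nn0 nn0 nn0 fun p hp => ?_
    show (hkMixedTerm α 1 1 (α • Dz Ψ) p.1 p.2) ^ 2 ≤ α ^ 2 * 1 * (radialWeight p.1 ^ 2 * dθ (Dz^[2] Ψ) p.1 p.2 ^ 2 * Real.sin (2 * p.2) ^ (2 - gammaExp α)) + 0 * ((0:ℝ)) + 0 * ((0:ℝ)) + 0 * ((0:ℝ))
    rw [hkMixedTerm_smul]
    simp only [Pi.smul_apply, smul_eq_mul]
    rw [mul_pow, sq_hkMixedTerm α 1 1 _ hp, ← Function.iterate_succ_apply Dz 1 Ψ]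
    try simp only [Nat.reduceAdd, Nat.reduceMul, Nat.reducePow, Nat.cast_one, Nat.cast_ofNat, Finset.sum_range_succ, Finset.sum_range_zero, zero_add, Function.iterate_zero, id_eq, iterate_dθ_one, iterate_dθ_two]
    have u := up_one (regΨj4 2 (by norm_num)) (gammaExp α) hp
    try simp only [Nat.reduceAdd, Nat.reduceMul, Nat.reducePow, Nat.cast_one, Nat.cast_ofNat, Finset.sum_range_succ, Finset.sum_range_zero, zero_add, Function.iterate_zero, id_eq, iterate_dθ_one, iterate_dθ_two] at u
    have u' := mul_le_mul_of_nonneg_left u hα20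
    linarith only [u']
  have b_f2_m11 : eL2Sq (hkMixedTerm α 1 1 (α • Dz Ψ)) ≤ ENNReal.ofReal (300000000000000000000000 * D) := by
    refine t_f2_m11.trans (ENNReal.ofReal_le_ofReal ?_)
    simp only [z0]
    linarith only [w1_f2_11, hY2, dL2, nH1_f2_11, aH1_f2_11, hD0, hα20, hα40, hα2, hα4']
  have w1_f2_12 := integral_weight_rpow_le_singular hWc hW0 (cΨ 1 3 (by norm_num)) (sΨ 1 3) (pΨ 1 3) hr0_1
  try simp only [Nat.reduceAdd, Nat.reduceMul, Nat.reducePow, Nat.cast_one, Nat.cast_ofNat, Finset.sum_range_succ, Finset.sum_range_zero, zero_add, Function.iterate_zero, id_eq, iterate_dθ_one, iterate_dθ_two] at w1_f2_12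
  have nH1_f2_12 : 0 ≤ ∫ p in strip, radialWeight p.1 ^ 2 * dθ (Dz^[3] Ψ) p.1 p.2 ^ 2 * Real.sin (2 * p.2) ^ (2 - gammaExp α) := setIntegral_nonneg measurableSet_strip fun p hp => nnW p hp _ _
  have aH1_f2_12 : α ^ 2 * 1 * (∫ p in strip, radialWeight p.1 ^ 2 * dθ (Dz^[3] Ψ) p.1 p.2 ^ 2 * Real.sin (2 * p.2) ^ (2 - gammaExp α)) ≤ 1 * 1 * ∫ p in strip, radialWeight p.1 ^ 2 * dθ (Dz^[3] Ψ) p.1 p.2 ^ 2 * Real.sin (2 * p.2) ^ (2 - gammaExp α) :=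
    mul_le_mul_of_nonneg_right (mul_le_mul_of_nonneg_right hα2 (by norm_num)) nH1_f2_12
  ----------------------------------------------------------------
  -- f2: mixed term (1, 2)
  have t_f2_m12 : eL2Sq (hkMixedTerm α 1 2 (α • Dz Ψ)) ≤ ENNReal.ofReal (α ^ 2 * 1 * (∫ p in strip, (fun p : ℝ × ℝ => radialWeight p.1 ^ 2 * dθ (Dz^[3] Ψ) p.1 p.2 ^ 2 * Real.sin (2 * p.2) ^ (2 - gammaExp α)) p) + 0 * (∫ p in strip, (fun _ : ℝ × ℝ => (0 : ℝ)) p) +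
      0 * (∫ p in strip, (fun _ : ℝ × ℝ => (0 : ℝ)) p) + 0 * ∫ p in strip, (fun _ : ℝ × ℝ => (0 : ℝ)) p) := by
    refine eL2Sq_le_ofReal_add4 (H₁ := (fun p : ℝ × ℝ => radialWeight p.1 ^ 2 * dθ (Dz^[3] Ψ) p.1 p.2 ^ 2 * Real.sin (2 * p.2) ^ (2 - gammaExp α))) (H₂ := (fun _ : ℝ × ℝ => (0 : ℝ))) (H₃ := (fun _ : ℝ × ℝ => (0 : ℝ))) (H₄ := (fun _ : ℝ × ℝ => (0 : ℝ)))
      (by positivity) (by positivity) (by positivity) (by positivity) (iRpow (cΨ 1 3 (by norm_num)) (sΨ 1 3) (pΨ 1 3) hr0_1) i0 i0 i0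
      (fun p hp => nnW p hp _ _) nn0 nn0 nn0 fun p hp => ?_
    show (hkMixedTerm α 1 2 (α • Dz Ψ) p.1 p.2) ^ 2 ≤ α ^ 2 * 1 * (radialWeight p.1 ^ 2 * dθ (Dz^[3] Ψ) p.1 p.2 ^ 2 * Real.sin (2 * p.2) ^ (2 - gammaExp α)) + 0 * ((0:ℝ)) + 0 * ((0:ℝ)) + 0 * ((0:ℝ))
    rw [hkMixedTerm_smul]
    simp only [Pi.smul_apply, smul_eq_mul]
    rw [mul_pow, sq_hkMixedTerm α 1 2 _ hp, ← Function.iterate_succ_apply Dz 2 Ψ]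
    try simp only [Nat.reduceAdd, Nat.reduceMul, Nat.reducePow, Nat.cast_one, Nat.cast_ofNat, Finset.sum_range_succ, Finset.sum_range_zero, zero_add, Function.iterate_zero, id_eq, iterate_dθ_one, iterate_dθ_two]
    have u := up_one (regΨj4 3 (by norm_num)) (gammaExp α) hp
    try simp only [Nat.reduceAdd, Nat.reduceMul, Nat.reducePow, Nat.cast_one, Nat.cast_ofNat, Finset.sum_range_succ, Finset.sum_range_zero, zero_add, Function.iterate_zero, id_eq, iterate_dθ_one, iterate_dθ_two] at u
    have u' := mul_le_mul_of_nonneg_left u hα20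
    linarith only [u']
  have b_f2_m12 : eL2Sq (hkMixedTerm α 1 2 (α • Dz Ψ)) ≤ ENNReal.ofReal (300000000000000000000000 * D) := by
    refine t_f2_m12.trans (ENNReal.ofReal_le_ofReal ?_)
    simp only [z0]
    linarith only [w1_f2_12, hY3, dL3, nH1_f2_12, aH1_f2_12, hD0, hα20, hα40, hα2, hα4']
  have w1_f2_13 := integral_weight_rpow_le_singular hWc hW0 (cΨ 1 4 (by norm_num)) (sΨ 1 4) (pΨ 1 4) hr0_1
  try simp only [Nat.reduceAdd, Nat.reduceMul, Nat.reducePow, Nat.cast_one, Nat.cast_ofNat, Finset.sum_range_succ, Finset.sum_range_zero, zero_add, Function.iterate_zero, id_eq, iterate_dθ_one, iterate_dθ_two] at w1_f2_13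
  have nH1_f2_13 : 0 ≤ ∫ p in strip, radialWeight p.1 ^ 2 * dθ (Dz^[4] Ψ) p.1 p.2 ^ 2 * Real.sin (2 * p.2) ^ (2 - gammaExp α) := setIntegral_nonneg measurableSet_strip fun p hp => nnW p hp _ _
  have aH1_f2_13 : α ^ 2 * 1 * (∫ p in strip, radialWeight p.1 ^ 2 * dθ (Dz^[4] Ψ) p.1 p.2 ^ 2 * Real.sin (2 * p.2) ^ (2 - gammaExp α)) ≤ 1 * 1 * ∫ p in strip, radialWeight p.1 ^ 2 * dθ (Dz^[4] Ψ) p.1 p.2 ^ 2 * Real.sin (2 * p.2) ^ (2 - gammaExp α) :=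
    mul_le_mul_of_nonneg_right (mul_le_mul_of_nonneg_right hα2 (by norm_num)) nH1_f2_13
  ----------------------------------------------------------------
  -- f2: mixed term (1, 3)
  have t_f2_m13 : eL2Sq (hkMixedTerm α 1 3 (α • Dz Ψ)) ≤ ENNReal.ofReal (α ^ 2 * 1 * (∫ p in strip, (fun p : ℝ × ℝ => radialWeight p.1 ^ 2 * dθ (Dz^[4] Ψ) p.1 p.2 ^ 2 * Real.sin (2 * p.2) ^ (2 - gammaExp α)) p) + 0 * (∫ p in strip, (fun _ : ℝ × ℝ => (0 : ℝ)) p) +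
      0 * (∫ p in strip, (fun _ : ℝ × ℝ => (0 : ℝ)) p) + 0 * ∫ p in strip, (fun _ : ℝ × ℝ => (0 : ℝ)) p) := by
    refine eL2Sq_le_ofReal_add4 (H₁ := (fun p : ℝ × ℝ => radialWeight p.1 ^ 2 * dθ (Dz^[4] Ψ) p.1 p.2 ^ 2 * Real.sin (2 * p.2) ^ (2 - gammaExp α))) (H₂ := (fun _ : ℝ × ℝ => (0 : ℝ))) (H₃ := (fun _ : ℝ × ℝ => (0 : ℝ))) (H₄ := (fun _ : ℝ × ℝ => (0 : ℝ)))
      (by positivity) (by positivity) (by positivity) (by positivity) (iRpow (cΨ 1 4 (by norm_num)) (sΨ 1 4) (pΨ 1 4) hr0_1) i0 i0 i0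
      (fun p hp => nnW p hp _ _) nn0 nn0 nn0 fun p hp => ?_
    show (hkMixedTerm α 1 3 (α • Dz Ψ) p.1 p.2) ^ 2 ≤ α ^ 2 * 1 * (radialWeight p.1 ^ 2 * dθ (Dz^[4] Ψ) p.1 p.2 ^ 2 * Real.sin (2 * p.2) ^ (2 - gammaExp α)) + 0 * ((0:ℝ)) + 0 * ((0:ℝ)) + 0 * ((0:ℝ))
    rw [hkMixedTerm_smul]
    simp only [Pi.smul_apply, smul_eq_mul]
    rw [mul_pow, sq_hkMixedTerm α 1 3 _ hp, ← Function.iterate_succ_apply Dz 3 Ψ]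
    try simp only [Nat.reduceAdd, Nat.reduceMul, Nat.reducePow, Nat.cast_one, Nat.cast_ofNat, Finset.sum_range_succ, Finset.sum_range_zero, zero_add, Function.iterate_zero, id_eq, iterate_dθ_one, iterate_dθ_two]
    have u := up_one (regΨj4 4 (by norm_num)) (gammaExp α) hp
    try simp only [Nat.reduceAdd, Nat.reduceMul, Nat.reducePow, Nat.cast_one, Nat.cast_ofNat, Finset.sum_range_succ, Finset.sum_range_zero, zero_add, Function.iterate_zero, id_eq, iterate_dθ_one, iterate_dθ_two] at u
    have u' := mul_le_mul_of_nonneg_left u hα20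
    linarith only [u']
  have b_f2_m13 : eL2Sq (hkMixedTerm α 1 3 (α • Dz Ψ)) ≤ ENNReal.ofReal (300000000000000000000000 * D) := by
    refine t_f2_m13.trans (ENNReal.ofReal_le_ofReal ?_)
    simp only [z0]
    linarith only [w1_f2_13, hY4, dL4, nH1_f2_13, aH1_f2_13, hD0, hα20, hα40, hα2, hα4']
  have w1_f2_20 := integral_weight_rpow_le_singular hWc hW0 (cΨ 1 1 (by norm_num)) (sΨ 1 1) (pΨ 1 1) hr0_1
  try simp only [Nat.reduceAdd, Nat.reduceMul, Nat.reducePow, Nat.cast_one, Nat.cast_ofNat, Finset.sum_range_succ, Finset.sum_range_zero, zero_add, Function.iterate_zero, id_eq, iterate_dθ_one, iterate_dθ_two] at w1_f2_20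
  have nH1_f2_20 : 0 ≤ ∫ p in strip, radialWeight p.1 ^ 2 * dθ (Dz^[1] Ψ) p.1 p.2 ^ 2 * Real.sin (2 * p.2) ^ (2 - gammaExp α) := setIntegral_nonneg measurableSet_strip fun p hp => nnW p hp _ _
  have aH1_f2_20 : α ^ 2 * 8 * (∫ p in strip, radialWeight p.1 ^ 2 * dθ (Dz^[1] Ψ) p.1 p.2 ^ 2 * Real.sin (2 * p.2) ^ (2 - gammaExp α)) ≤ 1 * 8 * ∫ p in strip, radialWeight p.1 ^ 2 * dθ (Dz^[1] Ψ) p.1 p.2 ^ 2 * Real.sin (2 * p.2) ^ (2 - gammaExp α) :=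
    mul_le_mul_of_nonneg_right (mul_le_mul_of_nonneg_right hα2 (by norm_num)) nH1_f2_20
  have w2_f2_20 := integral_weight_rpow_le_singular hWc hW0 (cΨ 2 1 (by norm_num)) (sΨ 2 1) (pΨ 2 1) hr0_2
  try simp only [Nat.reduceAdd, Nat.reduceMul, Nat.reducePow, Nat.cast_one, Nat.cast_ofNat, Finset.sum_range_succ, Finset.sum_range_zero, zero_add, Function.iterate_zero, id_eq, iterate_dθ_one, iterate_dθ_two] at w2_f2_20
  have nH2_f2_20 : 0 ≤ ∫ p in strip, radialWeight p.1 ^ 2 * dθ (dθ (Dz^[1] Ψ)) p.1 p.2 ^ 2 * Real.sin (2 * p.2) ^ (4 - gammaExp α) := setIntegral_nonneg measurableSet_strip fun p hp => nnW p hp _ _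
  have aH2_f2_20 : α ^ 2 * 2 * (∫ p in strip, radialWeight p.1 ^ 2 * dθ (dθ (Dz^[1] Ψ)) p.1 p.2 ^ 2 * Real.sin (2 * p.2) ^ (4 - gammaExp α)) ≤ 1 * 2 * ∫ p in strip, radialWeight p.1 ^ 2 * dθ (dθ (Dz^[1] Ψ)) p.1 p.2 ^ 2 * Real.sin (2 * p.2) ^ (4 - gammaExp α) :=
    mul_le_mul_of_nonneg_right (mul_le_mul_of_nonneg_right hα2 (by norm_num)) nH2_f2_20
  ----------------------------------------------------------------
  -- f2: mixed term (2, 0)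
  have t_f2_m20 : eL2Sq (hkMixedTerm α 2 0 (α • Dz Ψ)) ≤ ENNReal.ofReal (α ^ 2 * 8 * (∫ p in strip, (fun p : ℝ × ℝ => radialWeight p.1 ^ 2 * dθ (Dz^[1] Ψ) p.1 p.2 ^ 2 * Real.sin (2 * p.2) ^ (2 - gammaExp α)) p) + α ^ 2 * 2 * (∫ p in strip, (fun p : ℝ × ℝ => radialWeight p.1 ^ 2 * dθ (dθ (Dz^[1] Ψ)) p.1 p.2 ^ 2 * Real.sin (2 * p.2) ^ (4 - gammaExp α)) p) +
      0 * (∫ p in strip, (fun _ : ℝ × ℝ => (0 : ℝ)) p) + 0 * ∫ p in strip, (fun _ : ℝ × ℝ => (0 : ℝ)) p) := by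
    refine eL2Sq_le_ofReal_add4 (H₁ := (fun p : ℝ × ℝ => radialWeight p.1 ^ 2 * dθ (Dz^[1] Ψ) p.1 p.2 ^ 2 * Real.sin (2 * p.2) ^ (2 - gammaExp α))) (H₂ := (fun p : ℝ × ℝ => radialWeight p.1 ^ 2 * dθ (dθ (Dz^[1] Ψ)) p.1 p.2 ^ 2 * Real.sin (2 * p.2) ^ (4 - gammaExp α))) (H₃ := (fun _ : ℝ × ℝ => (0 : ℝ))) (H₄ := (fun _ : ℝ × ℝ => (0 : ℝ)))
      (by positivity) (by positivity) (by positivity) (by positivity) (iRpow (cΨ 1 1 (by norm_num)) (sΨ 1 1) (pΨ 1 1) hr0_1) (iRpow (cΨ 2 1 (by norm_num)) (sΨ 2 1) (pΨ 2 1) hr0_2) i0 i0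
      (fun p hp => nnW p hp _ _) (fun p hp => nnW p hp _ _) nn0 nn0 fun p hp => ?_
    show (hkMixedTerm α 2 0 (α • Dz Ψ) p.1 p.2) ^ 2 ≤ α ^ 2 * 8 * (radialWeight p.1 ^ 2 * dθ (Dz^[1] Ψ) p.1 p.2 ^ 2 * Real.sin (2 * p.2) ^ (2 - gammaExp α)) + α ^ 2 * 2 * (radialWeight p.1 ^ 2 * dθ (dθ (Dz^[1] Ψ)) p.1 p.2 ^ 2 * Real.sin (2 * p.2) ^ (4 - gammaExp α)) + 0 * ((0:ℝ)) + 0 * ((0:ℝ))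
    rw [hkMixedTerm_smul]
    simp only [Pi.smul_apply, smul_eq_mul]
    rw [mul_pow, sq_hkMixedTerm α 2 0 _ hp, ← Function.iterate_succ_apply Dz 0 Ψ]
    try simp only [Nat.reduceAdd, Nat.reduceMul, Nat.reducePow, Nat.cast_one, Nat.cast_ofNat, Finset.sum_range_succ, Finset.sum_range_zero, zero_add, Function.iterate_zero, id_eq, iterate_dθ_one, iterate_dθ_two]
    have u := up_two (regΨj4 1 (by norm_num)) (gammaExp α) hp
    try simp only [Nat.reduceAdd, Nat.reduceMul, Nat.reducePow, Nat.cast_one, Nat.cast_ofNat, Finset.sum_range_succ, Finset.sum_range_zero, zero_add, Function.iterate_zero, id_eq, iterate_dθ_one, iterate_dθ_two] at u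
    have u' := mul_le_mul_of_nonneg_left u hα20
    linarith only [u']
  have b_f2_m20 : eL2Sq (hkMixedTerm α 2 0 (α • Dz Ψ)) ≤ ENNReal.ofReal (300000000000000000000000 * D) := by
    refine t_f2_m20.trans (ENNReal.ofReal_le_ofReal ?_)
    simp only [z0]
    linarith only [w1_f2_20, hY1, dL1, nH1_f2_20, aH1_f2_20, w2_f2_20, hP1, dL1, nH2_f2_20, aH2_f2_20, hD0, hα20, hα40, hα2, hα4']
  have w1_f2_21 := integral_weight_rpow_le_singular hWc hW0 (cΨ 1 2 (by norm_num)) (sΨ 1 2) (pΨ 1 2) hr0_1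
  try simp only [Nat.reduceAdd, Nat.reduceMul, Nat.reducePow, Nat.cast_one, Nat.cast_ofNat, Finset.sum_range_succ, Finset.sum_range_zero, zero_add, Function.iterate_zero, id_eq, iterate_dθ_one, iterate_dθ_two] at w1_f2_21
  have nH1_f2_21 : 0 ≤ ∫ p in strip, radialWeight p.1 ^ 2 * dθ (Dz^[2] Ψ) p.1 p.2 ^ 2 * Real.sin (2 * p.2) ^ (2 - gammaExp α) := setIntegral_nonneg measurableSet_strip fun p hp => nnW p hp _ _
  have aH1_f2_21 : α ^ 2 * 8 * (∫ p in strip, radialWeight p.1 ^ 2 * dθ (Dz^[2] Ψ) p.1 p.2 ^ 2 * Real.sin (2 * p.2) ^ (2 - gammaExp α)) ≤ 1 * 8 * ∫ p in strip, radialWeight p.1 ^ 2 * dθ (Dz^[2] Ψ) p.1 p.2 ^ 2 * Real.sin (2 * p.2) ^ (2 - gammaExp α) :=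
    mul_le_mul_of_nonneg_right (mul_le_mul_of_nonneg_right hα2 (by norm_num)) nH1_f2_21
  have w2_f2_21 := integral_weight_rpow_le_singular hWc hW0 (cΨ 2 2 (by norm_num)) (sΨ 2 2) (pΨ 2 2) hr0_2
  try simp only [Nat.reduceAdd, Nat.reduceMul, Nat.reducePow, Nat.cast_one, Nat.cast_ofNat, Finset.sum_range_succ, Finset.sum_range_zero, zero_add, Function.iterate_zero, id_eq, iterate_dθ_one, iterate_dθ_two] at w2_f2_21
  have nH2_f2_21 : 0 ≤ ∫ p in strip, radialWeight p.1 ^ 2 * dθ (dθ (Dz^[2] Ψ)) p.1 p.2 ^ 2 * Real.sin (2 * p.2) ^ (4 - gammaExp α) := setIntegral_nonneg measurableSet_strip fun p hp => nnW p hp _ _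
  have aH2_f2_21 : α ^ 2 * 2 * (∫ p in strip, radialWeight p.1 ^ 2 * dθ (dθ (Dz^[2] Ψ)) p.1 p.2 ^ 2 * Real.sin (2 * p.2) ^ (4 - gammaExp α)) ≤ 1 * 2 * ∫ p in strip, radialWeight p.1 ^ 2 * dθ (dθ (Dz^[2] Ψ)) p.1 p.2 ^ 2 * Real.sin (2 * p.2) ^ (4 - gammaExp α) :=
    mul_le_mul_of_nonneg_right (mul_le_mul_of_nonneg_right hα2 (by norm_num)) nH2_f2_21
  ----------------------------------------------------------------
  -- f2: mixed term (2, 1)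
  have t_f2_m21 : eL2Sq (hkMixedTerm α 2 1 (α • Dz Ψ)) ≤ ENNReal.ofReal (α ^ 2 * 8 * (∫ p in strip, (fun p : ℝ × ℝ => radialWeight p.1 ^ 2 * dθ (Dz^[2] Ψ) p.1 p.2 ^ 2 * Real.sin (2 * p.2) ^ (2 - gammaExp α)) p) + α ^ 2 * 2 * (∫ p in strip, (fun p : ℝ × ℝ => radialWeight p.1 ^ 2 * dθ (dθ (Dz^[2] Ψ)) p.1 p.2 ^ 2 * Real.sin (2 * p.2) ^ (4 - gammaExp α)) p) +
      0 * (∫ p in strip, (fun _ : ℝ × ℝ => (0 : ℝ)) p) + 0 * ∫ p in strip, (fun _ : ℝ × ℝ => (0 : ℝ)) p) := by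
    refine eL2Sq_le_ofReal_add4 (H₁ := (fun p : ℝ × ℝ => radialWeight p.1 ^ 2 * dθ (Dz^[2] Ψ) p.1 p.2 ^ 2 * Real.sin (2 * p.2) ^ (2 - gammaExp α))) (H₂ := (fun p : ℝ × ℝ => radialWeight p.1 ^ 2 * dθ (dθ (Dz^[2] Ψ)) p.1 p.2 ^ 2 * Real.sin (2 * p.2) ^ (4 - gammaExp α))) (H₃ := (fun _ : ℝ × ℝ => (0 : ℝ))) (H₄ := (fun _ : ℝ × ℝ => (0 : ℝ)))
      (by positivity) (by positivity) (by positivity) (by positivity) (iRpow (cΨ 1 2 (by norm_num)) (sΨ 1 2) (pΨ 1 2) hr0_1) (iRpow (cΨ 2 2 (by norm_num)) (sΨ 2 2) (pΨ 2 2) hr0_2) i0 i0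
      (fun p hp => nnW p hp _ _) (fun p hp => nnW p hp _ _) nn0 nn0 fun p hp => ?_
    show (hkMixedTerm α 2 1 (α • Dz Ψ) p.1 p.2) ^ 2 ≤ α ^ 2 * 8 * (radialWeight p.1 ^ 2 * dθ (Dz^[2] Ψ) p.1 p.2 ^ 2 * Real.sin (2 * p.2) ^ (2 - gammaExp α)) + α ^ 2 * 2 * (radialWeight p.1 ^ 2 * dθ (dθ (Dz^[2] Ψ)) p.1 p.2 ^ 2 * Real.sin (2 * p.2) ^ (4 - gammaExp α)) + 0 * ((0:ℝ)) + 0 * ((0:ℝ))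
    rw [hkMixedTerm_smul]
    simp only [Pi.smul_apply, smul_eq_mul]
    rw [mul_pow, sq_hkMixedTerm α 2 1 _ hp, ← Function.iterate_succ_apply Dz 1 Ψ]
    try simp only [Nat.reduceAdd, Nat.reduceMul, Nat.reducePow, Nat.cast_one, Nat.cast_ofNat, Finset.sum_range_succ, Finset.sum_range_zero, zero_add, Function.iterate_zero, id_eq, iterate_dθ_one, iterate_dθ_two]
    have u := up_two (regΨj4 2 (by norm_num)) (gammaExp α) hp
    try simp only [Nat.reduceAdd, Nat.reduceMul, Nat.reducePow, Nat.cast_one, Nat.cast_ofNat, Finset.sum_range_succ, Finset.sum_range_zero, zero_add, Function.iterate_zero, id_eq, iterate_dθ_one, iterate_dθ_two] at u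
    have u' := mul_le_mul_of_nonneg_left u hα20
    linarith only [u']
  have b_f2_m21 : eL2Sq (hkMixedTerm α 2 1 (α • Dz Ψ)) ≤ ENNReal.ofReal (300000000000000000000000 * D) := by
    refine t_f2_m21.trans (ENNReal.ofReal_le_ofReal ?_)
    simp only [z0]
    linarith only [w1_f2_21, hY2, dL2, nH1_f2_21, aH1_f2_21, w2_f2_21, hP2, dL2, nH2_f2_21, aH2_f2_21, hD0, hα20, hα40, hα2, hα4']
  have w1_f2_22 := integral_weight_rpow_le_singular hWc hW0 (cΨ 1 3 (by norm_num)) (sΨ 1 3) (pΨ 1 3) hr0_1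
  try simp only [Nat.reduceAdd, Nat.reduceMul, Nat.reducePow, Nat.cast_one, Nat.cast_ofNat, Finset.sum_range_succ, Finset.sum_range_zero, zero_add, Function.iterate_zero, id_eq, iterate_dθ_one, iterate_dθ_two] at w1_f2_22
  have nH1_f2_22 : 0 ≤ ∫ p in strip, radialWeight p.1 ^ 2 * dθ (Dz^[3] Ψ) p.1 p.2 ^ 2 * Real.sin (2 * p.2) ^ (2 - gammaExp α) := setIntegral_nonneg measurableSet_strip fun p hp => nnW p hp _ _
  have aH1_f2_22 : α ^ 2 * 8 * (∫ p in strip, radialWeight p.1 ^ 2 * dθ (Dz^[3] Ψ) p.1 p.2 ^ 2 * Real.sin (2 * p.2) ^ (2 - gammaExp α)) ≤ 1 * 8 * ∫ p in strip, radialWeight p.1 ^ 2 * dθ (Dz^[3] Ψ) p.1 p.2 ^ 2 * Real.sin (2 * p.2) ^ (2 - gammaExp α) :=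
    mul_le_mul_of_nonneg_right (mul_le_mul_of_nonneg_right hα2 (by norm_num)) nH1_f2_22
  have w2_f2_22 := integral_weight_rpow_le_singular hWc hW0 (cΨ 2 3 (by norm_num)) (sΨ 2 3) (pΨ 2 3) hr0_2
  try simp only [Nat.reduceAdd, Nat.reduceMul, Nat.reducePow, Nat.cast_one, Nat.cast_ofNat, Finset.sum_range_succ, Finset.sum_range_zero, zero_add, Function.iterate_zero, id_eq, iterate_dθ_one, iterate_dθ_two] at w2_f2_22
  have nH2_f2_22 : 0 ≤ ∫ p in strip, radialWeight p.1 ^ 2 * dθ (dθ (Dz^[3] Ψ)) p.1 p.2 ^ 2 * Real.sin (2 * p.2) ^ (4 - gammaExp α) := setIntegral_nonneg measurableSet_strip fun p hp => nnW p hp _ _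
  have aH2_f2_22 : α ^ 2 * 2 * (∫ p in strip, radialWeight p.1 ^ 2 * dθ (dθ (Dz^[3] Ψ)) p.1 p.2 ^ 2 * Real.sin (2 * p.2) ^ (4 - gammaExp α)) ≤ 1 * 2 * ∫ p in strip, radialWeight p.1 ^ 2 * dθ (dθ (Dz^[3] Ψ)) p.1 p.2 ^ 2 * Real.sin (2 * p.2) ^ (4 - gammaExp α) :=
    mul_le_mul_of_nonneg_right (mul_le_mul_of_nonneg_right hα2 (by norm_num)) nH2_f2_22
  ----------------------------------------------------------------
  -- f2: mixed term (2, 2)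
  have t_f2_m22 : eL2Sq (hkMixedTerm α 2 2 (α • Dz Ψ)) ≤ ENNReal.ofReal (α ^ 2 * 8 * (∫ p in strip, (fun p : ℝ × ℝ => radialWeight p.1 ^ 2 * dθ (Dz^[3] Ψ) p.1 p.2 ^ 2 * Real.sin (2 * p.2) ^ (2 - gammaExp α)) p) + α ^ 2 * 2 * (∫ p in strip, (fun p : ℝ × ℝ => radialWeight p.1 ^ 2 * dθ (dθ (Dz^[3] Ψ)) p.1 p.2 ^ 2 * Real.sin (2 * p.2) ^ (4 - gammaExp α)) p) +
      0 * (∫ p in strip, (fun _ : ℝ × ℝ => (0 : ℝ)) p) + 0 * ∫ p in strip, (fun _ : ℝ × ℝ => (0 : ℝ)) p) := by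
    refine eL2Sq_le_ofReal_add4 (H₁ := (fun p : ℝ × ℝ => radialWeight p.1 ^ 2 * dθ (Dz^[3] Ψ) p.1 p.2 ^ 2 * Real.sin (2 * p.2) ^ (2 - gammaExp α))) (H₂ := (fun p : ℝ × ℝ => radialWeight p.1 ^ 2 * dθ (dθ (Dz^[3] Ψ)) p.1 p.2 ^ 2 * Real.sin (2 * p.2) ^ (4 - gammaExp α))) (H₃ := (fun _ : ℝ × ℝ => (0 : ℝ))) (H₄ := (fun _ : ℝ × ℝ => (0 : ℝ)))
      (by positivity) (by positivity) (by positivity) (by positivity) (iRpow (cΨ 1 3 (by norm_num)) (sΨ 1 3) (pΨ 1 3) hr0_1) (iRpow (cΨ 2 3 (by norm_num)) (sΨ 2 3) (pΨ 2 3) hr0_2) i0 i0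
      (fun p hp => nnW p hp _ _) (fun p hp => nnW p hp _ _) nn0 nn0 fun p hp => ?_
    show (hkMixedTerm α 2 2 (α • Dz Ψ) p.1 p.2) ^ 2 ≤ α ^ 2 * 8 * (radialWeight p.1 ^ 2 * dθ (Dz^[3] Ψ) p.1 p.2 ^ 2 * Real.sin (2 * p.2) ^ (2 - gammaExp α)) + α ^ 2 * 2 * (radialWeight p.1 ^ 2 * dθ (dθ (Dz^[3] Ψ)) p.1 p.2 ^ 2 * Real.sin (2 * p.2) ^ (4 - gammaExp α)) + 0 * ((0:ℝ)) + 0 * ((0:ℝ))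
    rw [hkMixedTerm_smul]
    simp only [Pi.smul_apply, smul_eq_mul]
    rw [mul_pow, sq_hkMixedTerm α 2 2 _ hp, ← Function.iterate_succ_apply Dz 2 Ψ]
    try simp only [Nat.reduceAdd, Nat.reduceMul, Nat.reducePow, Nat.cast_one, Nat.cast_ofNat, Finset.sum_range_succ, Finset.sum_range_zero, zero_add, Function.iterate_zero, id_eq, iterate_dθ_one, iterate_dθ_two]
    have u := up_two (regΨj4 3 (by norm_num)) (gammaExp α) hp
    try simp only [Nat.reduceAdd, Nat.reduceMul, Nat.reducePow, Nat.cast_one, Nat.cast_ofNat, Finset.sum_range_succ, Finset.sum_range_zero, zero_add, Function.iterate_zero, id_eq, iterate_dθ_one, iterate_dθ_two] at u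
    have u' := mul_le_mul_of_nonneg_left u hα20
    linarith only [u']
  have b_f2_m22 : eL2Sq (hkMixedTerm α 2 2 (α • Dz Ψ)) ≤ ENNReal.ofReal (300000000000000000000000 * D) := by
    refine t_f2_m22.trans (ENNReal.ofReal_le_ofReal ?_)
    simp only [z0]
    linarith only [w1_f2_22, hY3, dL3, nH1_f2_22, aH1_f2_22, w2_f2_22, hP3, dL3, nH2_f2_22, aH2_f2_22, hD0, hα20, hα40, hα2, hα4']
  have w1_f2_30 := integral_weight_rpow_le_singular hWc hW0 (cΨ 1 1 (by norm_num)) (sΨ 1 1) (pΨ 1 1) hr0_1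
  try simp only [Nat.reduceAdd, Nat.reduceMul, Nat.reducePow, Nat.cast_one, Nat.cast_ofNat, Finset.sum_range_succ, Finset.sum_range_zero, zero_add, Function.iterate_zero, id_eq, iterate_dθ_one, iterate_dθ_two] at w1_f2_30
  have nH1_f2_30 : 0 ≤ ∫ p in strip, radialWeight p.1 ^ 2 * dθ (Dz^[1] Ψ) p.1 p.2 ^ 2 * Real.sin (2 * p.2) ^ (2 - gammaExp α) := setIntegral_nonneg measurableSet_strip fun p hp => nnW p hp _ _
  have aH1_f2_30 : α ^ 2 * 48 * (∫ p in strip, radialWeight p.1 ^ 2 * dθ (Dz^[1] Ψ) p.1 p.2 ^ 2 * Real.sin (2 * p.2) ^ (2 - gammaExp α)) ≤ 1 * 48 * ∫ p in strip, radialWeight p.1 ^ 2 * dθ (Dz^[1] Ψ) p.1 p.2 ^ 2 * Real.sin (2 * p.2) ^ (2 - gammaExp α) :=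
    mul_le_mul_of_nonneg_right (mul_le_mul_of_nonneg_right hα2 (by norm_num)) nH1_f2_30
  have w2_f2_30 := integral_weight_rpow_le_singular hWc hW0 (cΨ 2 1 (by norm_num)) (sΨ 2 1) (pΨ 2 1) hr0_2
  try simp only [Nat.reduceAdd, Nat.reduceMul, Nat.reducePow, Nat.cast_one, Nat.cast_ofNat, Finset.sum_range_succ, Finset.sum_range_zero, zero_add, Function.iterate_zero, id_eq, iterate_dθ_one, iterate_dθ_two] at w2_f2_30
  have nH2_f2_30 : 0 ≤ ∫ p in strip, radialWeight p.1 ^ 2 * dθ (dθ (Dz^[1] Ψ)) p.1 p.2 ^ 2 * Real.sin (2 * p.2) ^ (4 - gammaExp α) := setIntegral_nonneg measurableSet_strip fun p hp => nnW p hp _ _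
  have aH2_f2_30 : α ^ 2 * 108 * (∫ p in strip, radialWeight p.1 ^ 2 * dθ (dθ (Dz^[1] Ψ)) p.1 p.2 ^ 2 * Real.sin (2 * p.2) ^ (4 - gammaExp α)) ≤ 1 * 108 * ∫ p in strip, radialWeight p.1 ^ 2 * dθ (dθ (Dz^[1] Ψ)) p.1 p.2 ^ 2 * Real.sin (2 * p.2) ^ (4 - gammaExp α) :=
    mul_le_mul_of_nonneg_right (mul_le_mul_of_nonneg_right hα2 (by norm_num)) nH2_f2_30
  have w3_f2_30 := integral_weight_rpow_mono hWc hW0 (cΨ 3 1 (by norm_num)) (sΨ 3 1) (pΨ 3 1) (r := 2 - gammaExp α) (r' := 6 - gammaExp α) hr0_1 (by linarith)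
  try simp only [Nat.reduceAdd, Nat.reduceMul, Nat.reducePow, Nat.cast_one, Nat.cast_ofNat, Finset.sum_range_succ, Finset.sum_range_zero, zero_add, Function.iterate_zero, id_eq, iterate_dθ_one, iterate_dθ_two] at w3_f2_30
  have nH3_f2_30 : 0 ≤ ∫ p in strip, radialWeight p.1 ^ 2 * (dθ^[3] (Dz^[1] Ψ)) p.1 p.2 ^ 2 * Real.sin (2 * p.2) ^ (6 - gammaExp α) := setIntegral_nonneg measurableSet_strip fun p hp => nnW p hp _ _
  have aH3_f2_30 : α ^ 2 * 3 * (∫ p in strip, radialWeight p.1 ^ 2 * (dθ^[3] (Dz^[1] Ψ)) p.1 p.2 ^ 2 * Real.sin (2 * p.2) ^ (6 - gammaExp α)) ≤ 1 * 3 * ∫ p in strip, radialWeight p.1 ^ 2 * (dθ^[3] (Dz^[1] Ψ)) p.1 p.2 ^ 2 * Real.sin (2 * p.2) ^ (6 - gammaExp α) :=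
    mul_le_mul_of_nonneg_right (mul_le_mul_of_nonneg_right hα2 (by norm_num)) nH3_f2_30
  ----------------------------------------------------------------
  -- f2: mixed term (3, 0)
  have t_f2_m30 : eL2Sq (hkMixedTerm α 3 0 (α • Dz Ψ)) ≤ ENNReal.ofReal (α ^ 2 * 48 * (∫ p in strip, (fun p : ℝ × ℝ => radialWeight p.1 ^ 2 * dθ (Dz^[1] Ψ) p.1 p.2 ^ 2 * Real.sin (2 * p.2) ^ (2 - gammaExp α)) p) + α ^ 2 * 108 * (∫ p in strip, (fun p : ℝ × ℝ => radialWeight p.1 ^ 2 * dθ (dθ (Dz^[1] Ψ)) p.1 p.2 ^ 2 * Real.sin (2 * p.2) ^ (4 - gammaExp α)) p) +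
      α ^ 2 * 3 * (∫ p in strip, (fun p : ℝ × ℝ => radialWeight p.1 ^ 2 * (dθ^[3] (Dz^[1] Ψ)) p.1 p.2 ^ 2 * Real.sin (2 * p.2) ^ (6 - gammaExp α)) p) + 0 * ∫ p in strip, (fun _ : ℝ × ℝ => (0 : ℝ)) p) := by
    refine eL2Sq_le_ofReal_add4 (H₁ := (fun p : ℝ × ℝ => radialWeight p.1 ^ 2 * dθ (Dz^[1] Ψ) p.1 p.2 ^ 2 * Real.sin (2 * p.2) ^ (2 - gammaExp α))) (H₂ := (fun p : ℝ × ℝ => radialWeight p.1 ^ 2 * dθ (dθ (Dz^[1] Ψ)) p.1 p.2 ^ 2 * Real.sin (2 * p.2) ^ (4 - gammaExp α))) (H₃ := (fun p : ℝ × ℝ => radialWeight p.1 ^ 2 * (dθ^[3] (Dz^[1] Ψ)) p.1 p.2 ^ 2 * Real.sin (2 * p.2) ^ (6 - gammaExp α))) (H₄ := (fun _ : ℝ × ℝ => (0 : ℝ)))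
      (by positivity) (by positivity) (by positivity) (by positivity) (iRpow (cΨ 1 1 (by norm_num)) (sΨ 1 1) (pΨ 1 1) hr0_1) (iRpow (cΨ 2 1 (by norm_num)) (sΨ 2 1) (pΨ 2 1) hr0_2) (iRpow (cΨ 3 1 (by norm_num)) (sΨ 3 1) (pΨ 3 1) hr0_3) i0
      (fun p hp => nnW p hp _ _) (fun p hp => nnW p hp _ _) (fun p hp => nnW p hp _ _) nn0 fun p hp => ?_
    show (hkMixedTerm α 3 0 (α • Dz Ψ) p.1 p.2) ^ 2 ≤ α ^ 2 * 48 * (radialWeight p.1 ^ 2 * dθ (Dz^[1] Ψ) p.1 p.2 ^ 2 * Real.sin (2 * p.2) ^ (2 - gammaExp α)) + α ^ 2 * 108 * (radialWeight p.1 ^ 2 * dθ (dθ (Dz^[1] Ψ)) p.1 p.2 ^ 2 * Real.sin (2 * p.2) ^ (4 - gammaExp α)) + α ^ 2 * 3 * (radialWeight p.1 ^ 2 * (dθ^[3] (Dz^[1] Ψ)) p.1 p.2 ^ 2 * Real.sin (2 * p.2) ^ (6 - gammaExp α)) + 0 * ((0:ℝ))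
    rw [hkMixedTerm_smul]
    simp only [Pi.smul_apply, smul_eq_mul]
    rw [mul_pow, sq_hkMixedTerm α 3 0 _ hp, ← Function.iterate_succ_apply Dz 0 Ψ]
    try simp only [Nat.reduceAdd, Nat.reduceMul, Nat.reducePow, Nat.cast_one, Nat.cast_ofNat, Finset.sum_range_succ, Finset.sum_range_zero, zero_add, Function.iterate_zero, id_eq, iterate_dθ_one, iterate_dθ_two]
    have u := up_three (regΨj4 1 (by norm_num)) (gammaExp α) hp
    try simp only [Nat.reduceAdd, Nat.reduceMul, Nat.reducePow, Nat.cast_one, Nat.cast_ofNat, Finset.sum_range_succ, Finset.sum_range_zero, zero_add, Function.iterate_zero, id_eq, iterate_dθ_one, iterate_dθ_two] at u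
    have u' := mul_le_mul_of_nonneg_left u hα20
    linarith only [u']
  have b_f2_m30 : eL2Sq (hkMixedTerm α 3 0 (α • Dz Ψ)) ≤ ENNReal.ofReal (300000000000000000000000 * D) := by
    refine t_f2_m30.trans (ENNReal.ofReal_le_ofReal ?_)
    simp only [z0]
    linarith only [w1_f2_30, hY1, dL1, nH1_f2_30, aH1_f2_30, w2_f2_30, hP1, dL1, nH2_f2_30, aH2_f2_30, w3_f2_30, bM11, nH3_f2_30, aH3_f2_30, hD0, hα20, hα40, hα2, hα4']
  have w1_f2_31 := integral_weight_rpow_le_singular hWc hW0 (cΨ 1 2 (by norm_num)) (sΨ 1 2) (pΨ 1 2) hr0_1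
  try simp only [Nat.reduceAdd, Nat.reduceMul, Nat.reducePow, Nat.cast_one, Nat.cast_ofNat, Finset.sum_range_succ, Finset.sum_range_zero, zero_add, Function.iterate_zero, id_eq, iterate_dθ_one, iterate_dθ_two] at w1_f2_31
  have nH1_f2_31 : 0 ≤ ∫ p in strip, radialWeight p.1 ^ 2 * dθ (Dz^[2] Ψ) p.1 p.2 ^ 2 * Real.sin (2 * p.2) ^ (2 - gammaExp α) := setIntegral_nonneg measurableSet_strip fun p hp => nnW p hp _ _
  have aH1_f2_31 : α ^ 2 * 48 * (∫ p in strip, radialWeight p.1 ^ 2 * dθ (Dz^[2] Ψ) p.1 p.2 ^ 2 * Real.sin (2 * p.2) ^ (2 - gammaExp α)) ≤ 1 * 48 * ∫ p in strip, radialWeight p.1 ^ 2 * dθ (Dz^[2] Ψ) p.1 p.2 ^ 2 * Real.sin (2 * p.2) ^ (2 - gammaExp α) :=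
    mul_le_mul_of_nonneg_right (mul_le_mul_of_nonneg_right hα2 (by norm_num)) nH1_f2_31
  have w2_f2_31 := integral_weight_rpow_le_singular hWc hW0 (cΨ 2 2 (by norm_num)) (sΨ 2 2) (pΨ 2 2) hr0_2
  try simp only [Nat.reduceAdd, Nat.reduceMul, Nat.reducePow, Nat.cast_one, Nat.cast_ofNat, Finset.sum_range_succ, Finset.sum_range_zero, zero_add, Function.iterate_zero, id_eq, iterate_dθ_one, iterate_dθ_two] at w2_f2_31
  have nH2_f2_31 : 0 ≤ ∫ p in strip, radialWeight p.1 ^ 2 * dθ (dθ (Dz^[2] Ψ)) p.1 p.2 ^ 2 * Real.sin (2 * p.2) ^ (4 - gammaExp α) := setIntegral_nonneg measurableSet_strip fun p hp => nnW p hp _ _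
  have aH2_f2_31 : α ^ 2 * 108 * (∫ p in strip, radialWeight p.1 ^ 2 * dθ (dθ (Dz^[2] Ψ)) p.1 p.2 ^ 2 * Real.sin (2 * p.2) ^ (4 - gammaExp α)) ≤ 1 * 108 * ∫ p in strip, radialWeight p.1 ^ 2 * dθ (dθ (Dz^[2] Ψ)) p.1 p.2 ^ 2 * Real.sin (2 * p.2) ^ (4 - gammaExp α) :=
    mul_le_mul_of_nonneg_right (mul_le_mul_of_nonneg_right hα2 (by norm_num)) nH2_f2_31
  have w3_f2_31 := integral_weight_rpow_mono hWc hW0 (cΨ 3 2 (by norm_num)) (sΨ 3 2) (pΨ 3 2) (r := 2 - gammaExp α) (r' := 6 - gammaExp α) hr0_1 (by linarith)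
  try simp only [Nat.reduceAdd, Nat.reduceMul, Nat.reducePow, Nat.cast_one, Nat.cast_ofNat, Finset.sum_range_succ, Finset.sum_range_zero, zero_add, Function.iterate_zero, id_eq, iterate_dθ_one, iterate_dθ_two] at w3_f2_31
  have nH3_f2_31 : 0 ≤ ∫ p in strip, radialWeight p.1 ^ 2 * (dθ^[3] (Dz^[2] Ψ)) p.1 p.2 ^ 2 * Real.sin (2 * p.2) ^ (6 - gammaExp α) := setIntegral_nonneg measurableSet_strip fun p hp => nnW p hp _ _
  have aH3_f2_31 : α ^ 2 * 3 * (∫ p in strip, radialWeight p.1 ^ 2 * (dθ^[3] (Dz^[2] Ψ)) p.1 p.2 ^ 2 * Real.sin (2 * p.2) ^ (6 - gammaExp α)) ≤ 1 * 3 * ∫ p in strip, radialWeight p.1 ^ 2 * (dθ^[3] (Dz^[2] Ψ)) p.1 p.2 ^ 2 * Real.sin (2 * p.2) ^ (6 - gammaExp α) :=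
    mul_le_mul_of_nonneg_right (mul_le_mul_of_nonneg_right hα2 (by norm_num)) nH3_f2_31
  ----------------------------------------------------------------
  -- f2: mixed term (3, 1)
  have t_f2_m31 : eL2Sq (hkMixedTerm α 3 1 (α • Dz Ψ)) ≤ ENNReal.ofReal (α ^ 2 * 48 * (∫ p in strip, (fun p : ℝ × ℝ => radialWeight p.1 ^ 2 * dθ (Dz^[2] Ψ) p.1 p.2 ^ 2 * Real.sin (2 * p.2) ^ (2 - gammaExp α)) p) + α ^ 2 * 108 * (∫ p in strip, (fun p : ℝ × ℝ => radialWeight p.1 ^ 2 * dθ (dθ (Dz^[2] Ψ)) p.1 p.2 ^ 2 * Real.sin (2 * p.2) ^ (4 - gammaExp α)) p) +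
      α ^ 2 * 3 * (∫ p in strip, (fun p : ℝ × ℝ => radialWeight p.1 ^ 2 * (dθ^[3] (Dz^[2] Ψ)) p.1 p.2 ^ 2 * Real.sin (2 * p.2) ^ (6 - gammaExp α)) p) + 0 * ∫ p in strip, (fun _ : ℝ × ℝ => (0 : ℝ)) p) := by
    refine eL2Sq_le_ofReal_add4 (H₁ := (fun p : ℝ × ℝ => radialWeight p.1 ^ 2 * dθ (Dz^[2] Ψ) p.1 p.2 ^ 2 * Real.sin (2 * p.2) ^ (2 - gammaExp α))) (H₂ := (fun p : ℝ × ℝ => radialWeight p.1 ^ 2 * dθ (dθ (Dz^[2] Ψ)) p.1 p.2 ^ 2 * Real.sin (2 * p.2) ^ (4 - gammaExp α))) (H₃ := (fun p : ℝ × ℝ => radialWeight p.1 ^ 2 * (dθ^[3] (Dz^[2] Ψ)) p.1 p.2 ^ 2 * Real.sin (2 * p.2) ^ (6 - gammaExp α))) (H₄ := (fun _ : ℝ × ℝ => (0 : ℝ)))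
      (by positivity) (by positivity) (by positivity) (by positivity) (iRpow (cΨ 1 2 (by norm_num)) (sΨ 1 2) (pΨ 1 2) hr0_1) (iRpow (cΨ 2 2 (by norm_num)) (sΨ 2 2) (pΨ 2 2) hr0_2) (iRpow (cΨ 3 2 (by norm_num)) (sΨ 3 2) (pΨ 3 2) hr0_3) i0
      (fun p hp => nnW p hp _ _) (fun p hp => nnW p hp _ _) (fun p hp => nnW p hp _ _) nn0 fun p hp => ?_
    show (hkMixedTerm α 3 1 (α • Dz Ψ) p.1 p.2) ^ 2 ≤ α ^ 2 * 48 * (radialWeight p.1 ^ 2 * dθ (Dz^[2] Ψ) p.1 p.2 ^ 2 * Real.sin (2 * p.2) ^ (2 - gammaExp α)) + α ^ 2 * 108 * (radialWeight p.1 ^ 2 * dθ (dθ (Dz^[2] Ψ)) p.1 p.2 ^ 2 * Real.sin (2 * p.2) ^ (4 - gammaExp α)) + α ^ 2 * 3 * (radialWeight p.1 ^ 2 * (dθ^[3] (Dz^[2] Ψ)) p.1 p.2 ^ 2 * Real.sin (2 * p.2) ^ (6 - gammaExp α)) + 0 * ((0:ℝ))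
    rw [hkMixedTerm_smul]
    simp only [Pi.smul_apply, smul_eq_mul]
    rw [mul_pow, sq_hkMixedTerm α 3 1 _ hp, ← Function.iterate_succ_apply Dz 1 Ψ]
    try simp only [Nat.reduceAdd, Nat.reduceMul, Nat.reducePow, Nat.cast_one, Nat.cast_ofNat, Finset.sum_range_succ, Finset.sum_range_zero, zero_add, Function.iterate_zero, id_eq, iterate_dθ_one, iterate_dθ_two]
    have u := up_three (regΨj4 2 (by norm_num)) (gammaExp α) hp
    try simp only [Nat.reduceAdd, Nat.reduceMul, Nat.reducePow, Nat.cast_one, Nat.cast_ofNat, Finset.sum_range_succ, Finset.sum_range_zero, zero_add, Function.iterate_zero, id_eq, iterate_dθ_one, iterate_dθ_two] at u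
    have u' := mul_le_mul_of_nonneg_left u hα20
    linarith only [u']
  have b_f2_m31 : eL2Sq (hkMixedTerm α 3 1 (α • Dz Ψ)) ≤ ENNReal.ofReal (300000000000000000000000 * D) := by
    refine t_f2_m31.trans (ENNReal.ofReal_le_ofReal ?_)
    simp only [z0]
    linarith only [w1_f2_31, hY2, dL2, nH1_f2_31, aH1_f2_31, w2_f2_31, hP2, dL2, nH2_f2_31, aH2_f2_31, w3_f2_31, bM12, nH3_f2_31, aH3_f2_31, hD0, hα20, hα40, hα2, hα4']
  have w1_f2_40 := integral_weight_rpow_le_singular hWc hW0 (cΨ 1 1 (by norm_num)) (sΨ 1 1) (pΨ 1 1) hr0_1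
  try simp only [Nat.reduceAdd, Nat.reduceMul, Nat.reducePow, Nat.cast_one, Nat.cast_ofNat, Finset.sum_range_succ, Finset.sum_range_zero, zero_add, Function.iterate_zero, id_eq, iterate_dθ_one, iterate_dθ_two] at w1_f2_40
  have nH1_f2_40 : 0 ≤ ∫ p in strip, radialWeight p.1 ^ 2 * dθ (Dz^[1] Ψ) p.1 p.2 ^ 2 * Real.sin (2 * p.2) ^ (2 - gammaExp α) := setIntegral_nonneg measurableSet_strip fun p hp => nnW p hp _ _
  have aH1_f2_40 : α ^ 2 * 6400 * (∫ p in strip, radialWeight p.1 ^ 2 * dθ (Dz^[1] Ψ) p.1 p.2 ^ 2 * Real.sin (2 * p.2) ^ (2 - gammaExp α)) ≤ 1 * 6400 * ∫ p in strip, radialWeight p.1 ^ 2 * dθ (Dz^[1] Ψ) p.1 p.2 ^ 2 * Real.sin (2 * p.2) ^ (2 - gammaExp α) :=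
    mul_le_mul_of_nonneg_right (mul_le_mul_of_nonneg_right hα2 (by norm_num)) nH1_f2_40
  have w2_f2_40 := integral_weight_rpow_le_singular hWc hW0 (cΨ 2 1 (by norm_num)) (sΨ 2 1) (pΨ 2 1) hr0_2
  try simp only [Nat.reduceAdd, Nat.reduceMul, Nat.reducePow, Nat.cast_one, Nat.cast_ofNat, Finset.sum_range_succ, Finset.sum_range_zero, zero_add, Function.iterate_zero, id_eq, iterate_dθ_one, iterate_dθ_two] at w2_f2_40
  have nH2_f2_40 : 0 ≤ ∫ p in strip, radialWeight p.1 ^ 2 * dθ (dθ (Dz^[1] Ψ)) p.1 p.2 ^ 2 * Real.sin (2 * p.2) ^ (4 - gammaExp α) := setIntegral_nonneg measurableSet_strip fun p hp => nnW p hp _ _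
  have aH2_f2_40 : α ^ 2 * 3136 * (∫ p in strip, radialWeight p.1 ^ 2 * dθ (dθ (Dz^[1] Ψ)) p.1 p.2 ^ 2 * Real.sin (2 * p.2) ^ (4 - gammaExp α)) ≤ 1 * 3136 * ∫ p in strip, radialWeight p.1 ^ 2 * dθ (dθ (Dz^[1] Ψ)) p.1 p.2 ^ 2 * Real.sin (2 * p.2) ^ (4 - gammaExp α) :=
    mul_le_mul_of_nonneg_right (mul_le_mul_of_nonneg_right hα2 (by norm_num)) nH2_f2_40
  have w3_f2_40 := integral_weight_rpow_mono hWc hW0 (cΨ 3 1 (by norm_num)) (sΨ 3 1) (pΨ 3 1) (r := 2 - gammaExp α) (r' := 6 - gammaExp α) hr0_1 (by linarith)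
  try simp only [Nat.reduceAdd, Nat.reduceMul, Nat.reducePow, Nat.cast_one, Nat.cast_ofNat, Finset.sum_range_succ, Finset.sum_range_zero, zero_add, Function.iterate_zero, id_eq, iterate_dθ_one, iterate_dθ_two] at w3_f2_40
  have nH3_f2_40 : 0 ≤ ∫ p in strip, radialWeight p.1 ^ 2 * (dθ^[3] (Dz^[1] Ψ)) p.1 p.2 ^ 2 * Real.sin (2 * p.2) ^ (6 - gammaExp α) := setIntegral_nonneg measurableSet_strip fun p hp => nnW p hp _ _
  have aH3_f2_40 : α ^ 2 * 576 * (∫ p in strip, radialWeight p.1 ^ 2 * (dθ^[3] (Dz^[1] Ψ)) p.1 p.2 ^ 2 * Real.sin (2 * p.2) ^ (6 - gammaExp α)) ≤ 1 * 576 * ∫ p in strip, radialWeight p.1 ^ 2 * (dθ^[3] (Dz^[1] Ψ)) p.1 p.2 ^ 2 * Real.sin (2 * p.2) ^ (6 - gammaExp α) :=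
    mul_le_mul_of_nonneg_right (mul_le_mul_of_nonneg_right hα2 (by norm_num)) nH3_f2_40
  have w4_f2_40 := integral_weight_rpow_mono hWc hW0 (cΨ 4 1 (by norm_num)) (sΨ 4 1) (pΨ 4 1) (r := 4 - gammaExp α) (r' := 8 - gammaExp α) hr0_2 (by linarith)
  try simp only [Nat.reduceAdd, Nat.reduceMul, Nat.reducePow, Nat.cast_one, Nat.cast_ofNat, Finset.sum_range_succ, Finset.sum_range_zero, zero_add, Function.iterate_zero, id_eq, iterate_dθ_one, iterate_dθ_two] at w4_f2_40
  have nH4_f2_40 : 0 ≤ ∫ p in strip, radialWeight p.1 ^ 2 * (dθ^[4] (Dz^[1] Ψ)) p.1 p.2 ^ 2 * Real.sin (2 * p.2) ^ (8 - gammaExp α) := setIntegral_nonneg measurableSet_strip fun p hp => nnW p hp _ _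
  have aH4_f2_40 : α ^ 2 * 4 * (∫ p in strip, radialWeight p.1 ^ 2 * (dθ^[4] (Dz^[1] Ψ)) p.1 p.2 ^ 2 * Real.sin (2 * p.2) ^ (8 - gammaExp α)) ≤ 1 * 4 * ∫ p in strip, radialWeight p.1 ^ 2 * (dθ^[4] (Dz^[1] Ψ)) p.1 p.2 ^ 2 * Real.sin (2 * p.2) ^ (8 - gammaExp α) :=
    mul_le_mul_of_nonneg_right (mul_le_mul_of_nonneg_right hα2 (by norm_num)) nH4_f2_40
  ----------------------------------------------------------------
  -- f2: mixed term (4, 0)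
  have t_f2_m40 : eL2Sq (hkMixedTerm α 4 0 (α • Dz Ψ)) ≤ ENNReal.ofReal (α ^ 2 * 6400 * (∫ p in strip, (fun p : ℝ × ℝ => radialWeight p.1 ^ 2 * dθ (Dz^[1] Ψ) p.1 p.2 ^ 2 * Real.sin (2 * p.2) ^ (2 - gammaExp α)) p) + α ^ 2 * 3136 * (∫ p in strip, (fun p : ℝ × ℝ => radialWeight p.1 ^ 2 * dθ (dθ (Dz^[1] Ψ)) p.1 p.2 ^ 2 * Real.sin (2 * p.2) ^ (4 - gammaExp α)) p) +
      α ^ 2 * 576 * (∫ p in strip, (fun p : ℝ × ℝ => radialWeight p.1 ^ 2 * (dθ^[3] (Dz^[1] Ψ)) p.1 p.2 ^ 2 * Real.sin (2 * p.2) ^ (6 - gammaExp α)) p) + α ^ 2 * 4 * ∫ p in strip, (fun p : ℝ × ℝ => radialWeight p.1 ^ 2 * (dθ^[4] (Dz^[1] Ψ)) p.1 p.2 ^ 2 * Real.sin (2 * p.2) ^ (8 - gammaExp α)) p) := by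
    refine eL2Sq_le_ofReal_add4 (H₁ := (fun p : ℝ × ℝ => radialWeight p.1 ^ 2 * dθ (Dz^[1] Ψ) p.1 p.2 ^ 2 * Real.sin (2 * p.2) ^ (2 - gammaExp α))) (H₂ := (fun p : ℝ × ℝ => radialWeight p.1 ^ 2 * dθ (dθ (Dz^[1] Ψ)) p.1 p.2 ^ 2 * Real.sin (2 * p.2) ^ (4 - gammaExp α))) (H₃ := (fun p : ℝ × ℝ => radialWeight p.1 ^ 2 * (dθ^[3] (Dz^[1] Ψ)) p.1 p.2 ^ 2 * Real.sin (2 * p.2) ^ (6 - gammaExp α))) (H₄ := (fun p : ℝ × ℝ => radialWeight p.1 ^ 2 * (dθ^[4] (Dz^[1] Ψ)) p.1 p.2 ^ 2 * Real.sin (2 * p.2) ^ (8 - gammaExp α)))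
      (by positivity) (by positivity) (by positivity) (by positivity) (iRpow (cΨ 1 1 (by norm_num)) (sΨ 1 1) (pΨ 1 1) hr0_1) (iRpow (cΨ 2 1 (by norm_num)) (sΨ 2 1) (pΨ 2 1) hr0_2) (iRpow (cΨ 3 1 (by norm_num)) (sΨ 3 1) (pΨ 3 1) hr0_3) (iRpow (cΨ 4 1 (by norm_num)) (sΨ 4 1) (pΨ 4 1) hr0_4)
      (fun p hp => nnW p hp _ _) (fun p hp => nnW p hp _ _) (fun p hp => nnW p hp _ _) (fun p hp => nnW p hp _ _) fun p hp => ?_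
    show (hkMixedTerm α 4 0 (α • Dz Ψ) p.1 p.2) ^ 2 ≤ α ^ 2 * 6400 * (radialWeight p.1 ^ 2 * dθ (Dz^[1] Ψ) p.1 p.2 ^ 2 * Real.sin (2 * p.2) ^ (2 - gammaExp α)) + α ^ 2 * 3136 * (radialWeight p.1 ^ 2 * dθ (dθ (Dz^[1] Ψ)) p.1 p.2 ^ 2 * Real.sin (2 * p.2) ^ (4 - gammaExp α)) + α ^ 2 * 576 * (radialWeight p.1 ^ 2 * (dθ^[3] (Dz^[1] Ψ)) p.1 p.2 ^ 2 * Real.sin (2 * p.2) ^ (6 - gammaExp α)) + α ^ 2 * 4 * (radialWeight p.1 ^ 2 * (dθ^[4] (Dz^[1] Ψ)) p.1 p.2 ^ 2 * Real.sin (2 * p.2) ^ (8 - gammaExp α))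
    rw [hkMixedTerm_smul]
    simp only [Pi.smul_apply, smul_eq_mul]
    rw [mul_pow, sq_hkMixedTerm α 4 0 _ hp, ← Function.iterate_succ_apply Dz 0 Ψ]
    try simp only [Nat.reduceAdd, Nat.reduceMul, Nat.reducePow, Nat.cast_one, Nat.cast_ofNat, Finset.sum_range_succ, Finset.sum_range_zero, zero_add, Function.iterate_zero, id_eq, iterate_dθ_one, iterate_dθ_two]
    have u := up_four (regΨj4 1 (by norm_num)) (gammaExp α) hp
    try simp only [Nat.reduceAdd, Nat.reduceMul, Nat.reducePow, Nat.cast_one, Nat.cast_ofNat, Finset.sum_range_succ, Finset.sum_range_zero, zero_add, Function.iterate_zero, id_eq, iterate_dθ_one, iterate_dθ_two] at u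
    have u' := mul_le_mul_of_nonneg_left u hα20
    linarith only [u']
  have b_f2_m40 : eL2Sq (hkMixedTerm α 4 0 (α • Dz Ψ)) ≤ ENNReal.ofReal (300000000000000000000000 * D) := by
    refine t_f2_m40.trans (ENNReal.ofReal_le_ofReal ?_)
    simp only [z0]
    linarith only [w1_f2_40, hY1, dL1, nH1_f2_40, aH1_f2_40, w2_f2_40, hP1, dL1, nH2_f2_40, aH2_f2_40, w3_f2_40, bM11, nH3_f2_40, aH3_f2_40, w4_f2_40, bM21, nH4_f2_40, aH4_f2_40, hD0, hα20, hα40, hα2, hα4']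
  have hrad : ∀ j, j ≤ 4 → eL2Sq (hkRadialTerm j (α • Dz Ψ)) ≤ ENNReal.ofReal (300000000000000000000000 * D) := by
    intro j hj
    interval_cases j
    · exact b_f2_r0
    · exact b_f2_r1
    · exact b_f2_r2
    · exact b_f2_r3
    · exact b_f2_r4
  have hmix : ∀ i j, 1 ≤ i → i + j ≤ 4 → eL2Sq (hkMixedTerm α i j (α • Dz Ψ)) ≤ ENNReal.ofReal (300000000000000000000000 * D) := by
    intro i j hi hij
    have hi4 : i ≤ 4 := by omega
    have hj4 : j ≤ 4 := by omega
    interval_cases i <;> interval_cases j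
    all_goals first | (exfalso; omega) | exact b_f2_m10 | exact b_f2_m11 | exact b_f2_m12 | exact b_f2_m13 | exact b_f2_m20 | exact b_f2_m21 | exact b_f2_m22 | exact b_f2_m30 | exact b_f2_m31 | exact b_f2_m40
  have E := eHkNormSq_le_of_forall_le (α := α) (k := 4) (f := (α • Dz Ψ)) hrad hmix
  have e30 : (((4 + 1) + (4 + 1) ^ 2 : ℕ) : ℝ≥0∞) = 30 := by norm_num
  rw [e30] at E
  exact E

end Elgindi

end Literature.Analysis.FluidPDE
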